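import Literature.Analysis.FluidPDE.ClassicalLerayProjection
import Literature.Analysis.FluidPDE.HessianLaplacianLpProofs
import Literature.Analysis.FluidPDE.NewtonPotentialGradient
import HarnessLib

/-!
# Calderón's splitting of a divergence-free `L^p` field, `1 < p < ∞` (Albritton 2018, (4.31))

Analysis/FluidPDE proofs file (theorems only) on the discharge path of the corrected form of
`Literature.Analysis.FluidPDE.albritton_singular_point_of_blowup` (Albritton 2018, Cor. 4.6 over
Albritton's class; `AlbrittonSingularPointKatoClass.lean`). The printed proof of Prop. 4.5
(arXiv:1612.04439, p. 23) opens: "Following Calderón [Cal90], for all `δ > 0`, there exist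
divergence-free vector fields `U₀ ∈ L²(ℝ³) ∩ L^p(ℝ³)` and `V₀ ∈ L^p(ℝ³)` such that
`u₀ = U₀ + V₀`, `‖V₀‖_{L^p(ℝ³)} < δ`" (C. P. Calderón, Trans. AMS 318 (1990), §1: split `u₀` at a
level / radius and re-project with the Leray projector, bounded on `L^p` by the Calderón–Zygmund
theorem). This file proves the splitting for the **smooth** divergence-free `L^p ∩ L^∞` fields to
which it is applied in the tree (the slices `u(t₀)`, `t₀ > 0`, of Albritton's class are classical,
`AlbrittonKatoClassIntegralForm.lean`), with the tree's classical Leray projection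
`P[G] = G − ∇π[G]`, `π[G] = Δ⁻¹ div G` of test fields (`ClassicalLerayProjection.lean`):

* §1 `exists_eLpNorm_hessian_newtonPotential_le` — **the Calderón–Zygmund bound for the Hessian of
  the Newtonian potential of a test function**, `‖∂ₐ∂_b(g ⋆ Γ)‖_{L^p} ≤ C_p ‖g‖_{L^p}`,
  `g ∈ C_c^∞(ℝ³)`, `‖a‖, ‖b‖ ≤ 1`, `1 < p < ∞`: the tree's *proved* Stein Prop. III.3
  (`stein1970_hessian_Lp_bound_holds_fin3`) in its scale-uniform form for truncated potentials
  (`stein1970_hessian_Lp_bound.hessian_newtonNearPotential_half`), and Fatou along the truncation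
  radius (near every point the full potential IS a truncated one for large radius,
  `convolution_newtonKernel_eq_newtonNearPotential`);
* §2 `exists_eLpNorm_gradient_divPotential_le` — hence **`∇Δ⁻¹div` is bounded on `L^p`** on test
  fields: `‖∇π[G]‖_{L^p} ≤ C_p ‖G‖_{L^p}` (`∂ᵢπ[G] = Σⱼ ∂ᵢ∂ⱼ(Gⱼ ⋆ Γ)`), so that
  `P[G] = G − ∇π[G] ∈ L^p` with `‖P[G]‖_p ≤ (1 + C_p)‖G‖_p` — the `L^p`-boundedness of the Leray
  projector on test fields (Calderón 1990, §1; Lemarié-Rieusset 2002, Ch. 11);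
* §3 `eLpNorm_gradient_divPotential_cutoff_le` — for a smooth divergence-free `a ∈ L^p` and the
  cut-off field `χ_ρ a` (`cutoff ρ`), `‖∇π[χ_ρ a]‖_{L^p} ≤ C_p ‖(1 − χ_ρ) a‖_{L^p}`: since
  `div a = 0`, `π[χ_ρ a] = π[χ_R a] − π[(1 − χ_ρ)χ_R a]` for `R ≥ 2ρ`, the second term is bounded
  by §2 uniformly in `R`, and `∇π[χ_R a](x) → 0` as `R → ∞` at every `x` (the source
  `div(χ_R a) = ⟪∇χ_R, a⟫` lives on the shell `R ≤ |y| ≤ 2R` and is `O(R⁻¹|a|)`, the kernel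
  gradient is `O(R⁻²)` there; Hölder); Fatou again;
* §4 `exists_calderon_splitting` — **the splitting**: for `1 < p < ∞`, a smooth bounded
  divergence-free `a ∈ L^p(ℝ³; ℝ³)` and `η > 0` there are smooth divergence-free `U₀`, `V₀` with
  `a = U₀ + V₀`, `U₀ ∈ L² ∩ L^p ∩ L^∞` (indeed `U₀ = P[χ_ρ a]`), `V₀ ∈ L^p ∩ L^∞` and
  `‖V₀‖_{L^p} ≤ η` (`V₀ = (1 − χ_ρ)a + ∇π[χ_ρ a]`, `ρ` large by dominated convergence);
* §5 `exists_calderon_splitting_sup` — the same with `V₀` also small in `L^∞`, `‖V₀(x)‖ ≤ η`,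
  when `a` has a bounded gradient (as the slices of Albritton's class do, KNSS 2009): a Lipschitz
  `L^p` field vanishes at infinity (`exists_forall_norm_le_of_memLp_of_lipschitz`), so the tail
  `(1 − χ_ρ)a` is uniformly small, and `‖∇π[χ_ρ a]‖_∞ ≲ sup_{|x| ≥ ρ} |a|` by the kernel-gradient
  representation of `∇π` (`integral_newtonKernel_smul_fderiv_eq`,
  `abs_fderiv_divPotential_le_of_support`). With `‖V₀‖_∞` small, the mild solution from `V₀` in
  the bounded class (`exists_oseen_fixedPoint_bounded`) lives as long as needed — the rôle of
  "`T*(V₀) ≥ 2T*(u₀)`" in Albritton's proof.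

## Mathlib / tree search

Tree (reused): `divPotential`, `classicalLerayProj`, `contDiff_divPotential`,
`isDivFree_classicalLerayProj`, `classicalLerayProj_apply` (`ClassicalLerayProjection`);
`stein1970_hessian_Lp_bound_holds_fin3` (`HessianLaplacianLpProofs`),
`stein1970_hessian_Lp_bound.hessian_newtonNearPotential_half` (`HessianLaplacianLp`);
`newtonNearPotential`, `contDiff_newtonNearPotential`, `newtonNear_eq_newtonKernel`
(`NewtonLocalPotential`, `NewtonKernel`); `convolution_newtonKernel_apply'`,
`fderiv_convolution_newtonKernel_apply`, `contDiff_convolution_newtonKernel`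
(`NewtonPotentialTestSource`); `integrable_newtonKernel_mul`, `newtonReg`,
`newtonReg_eq_newtonKernel`, `norm_fderiv_newtonReg` (`NormalisedPressureL2Bound`);
`divergence_smul_apply`, `cutoff`, `exists_norm_fderiv_cutoff_le` (`WholeSpaceIBP`);
`continuous_fderiv_fderiv_apply` (`HessianLaplacian`). Mathlib: `eLpNorm_lim_le_liminf_eLpNorm`,
`Filter.liminf_le_of_frequently_le'`, `eLpNorm_sum_le`, `tendsto_integral_of_dominated_convergence`.
`lean search 'calderon.*split|lerayProj.*Lp|gradient_divPotential'`: nothing.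

## References

* D. Albritton, Anal. PDE 11 (2018) 1415–1456 = arXiv:1612.04439, proof of Prop. 4.5, (4.31).
  [Albritton2018]
* C. P. Calderón, *Existence of weak solutions for the Navier–Stokes equations with initial data
  in `L^p`*, Trans. Amer. Math. Soc. 318 (1990) 179–200, §1. [Calderon1990]
* E. M. Stein, *Singular integrals and differentiability properties of functions* (1970),
  Ch. III §1.3, Prop. 3. [Stein1971]
* P. G. Lemarié-Rieusset, *Recent developments in the Navier–Stokes problem* (2002), Ch. 11
  (the Leray projector on `L^p`).
-/

noncomputable section

open MeasureTheory Set Filter Topology Function Metric ContinuousLinearMap InnerProductSpace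
open scoped ENNReal NNReal Convolution ContDiff Laplacian RealInnerProductSpace

namespace Literature.Analysis.FluidPDE

namespace CalderonSplittingLp

/-! ### §1 The Calderón–Zygmund bound for the Hessian of the Newtonian potential -/

section HessianNewton

variable {g : (EuclideanSpace ℝ (Fin 3)) → ℝ}

/-- Near every centre `y₀`, the Newtonian potential of a compactly supported `g` (support in
`B̄(0, R)`) coincides with the truncated potential `N_{r₀,r₁}[g]` as soon as the inner radius
`r₀ ≥ ‖y₀‖ + |R| + 1` (on `B(y₀, 1)` only kernel values `Γ(z)`, `‖z‖ ≤ r₀`, are sampled). [folklore] -/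
theorem convolution_newtonKernel_eq_newtonNearPotential (hgc : HasCompactSupport g) {R : ℝ}
    (hR : tsupport g ⊆ closedBall (0 : EuclideanSpace ℝ (Fin 3)) R) {r₀ r₁ : ℝ} (h₀ : 0 ≤ r₀)
    (h₁ : r₀ < r₁) (y₀ : EuclideanSpace ℝ (Fin 3)) (hr : ‖y₀‖ + |R| + 1 ≤ r₀)
    {y : EuclideanSpace ℝ (Fin 3)} (hy : y ∈ ball y₀ 1) :
    (g ⋆[lsmul ℝ ℝ, volume] newtonKernel) y = newtonNearPotential r₀ r₁ g y := by
  have _ := hgc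
  rw [convolution_newtonKernel_apply', newtonNearPotential_apply]
  have hpt : ∀ z, newtonNear r₀ r₁ z * g (y - z) = newtonKernel z * g (y - z) := fun z => by
    by_cases hz : y - z ∈ tsupport g
    · have h1 : ‖y - z‖ ≤ R := mem_closedBall_zero_iff.1 (hR hz)
      have hy' : ‖y - y₀‖ < 1 := by rwa [mem_ball, dist_eq_norm] at hy
      have hz' : ‖z‖ ≤ r₀ := by
        have e : z = (y - y₀) + y₀ - (y - z) := by abel
        calc ‖z‖ = ‖(y - y₀) + y₀ - (y - z)‖ := by rw [← e]
          _ ≤ ‖(y - y₀) + y₀‖ + ‖y - z‖ := norm_sub_le _ _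
          _ ≤ ‖y - y₀‖ + ‖y₀‖ + ‖y - z‖ := by linarith [norm_add_le (y - y₀) y₀]
          _ ≤ r₀ := by linarith [le_abs_self R]
      rw [newtonNear_eq_newtonKernel h₀ h₁ hz']
    · rw [image_eq_zero_of_notMem_tsupport hz, mul_zero, mul_zero]
  simp_rw [hpt]
  have h := integral_sub_left_eq_self (fun x => newtonKernel (y - x) * g x) volume y
  simp only [sub_sub_cancel] at h
  exact h.symm

/-- Mixed second directional derivatives agree for functions that agree near the point. [folklore] -/
theorem fderiv_fderiv_apply_congr_of_eventuallyEq' {f₁ f₂ : (EuclideanSpace ℝ (Fin 3)) → ℝ}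
    {x : EuclideanSpace ℝ (Fin 3)} (hfg : f₁ =ᶠ[𝓝 x] f₂) (a b : EuclideanSpace ℝ (Fin 3)) :
    fderiv ℝ (fun s => fderiv ℝ f₁ s a) x b = fderiv ℝ (fun s => fderiv ℝ f₂ s a) x b := by
  have h1 : (fun s => fderiv ℝ f₁ s a) =ᶠ[𝓝 x] fun s => fderiv ℝ f₂ s a := by
    filter_upwards [hfg.eventually_nhds] with w hw
    have hw' : f₁ =ᶠ[𝓝 w] f₂ := hw
    rw [hw'.fderiv_eq]
  rw [h1.fderiv_eq]

/-- **Calderón–Zygmund bound for the Hessian of the Newtonian potential of a test function**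
(Stein 1970, Ch. III §1.3 Prop. 3 in the form `∂ₐ∂_b Δ⁻¹`): for `1 < p < ∞` there is `C` with
`‖∂ₐ∂_b(g ⋆ Γ)‖_{L^p(ℝ³)} ≤ C ‖g‖_{L^p(ℝ³)}` for all `g ∈ C_c^∞(ℝ³)` and `‖a‖, ‖b‖ ≤ 1`. Proof: near
every `x` the potential `g ⋆ Γ` is the truncated potential `N_{r/2,r}[g]` for `r` large
(`convolution_newtonKernel_eq_newtonNearPotential`), whose Hessians are bounded on `L^p` uniformly
in `r` (`stein1970_hessian_Lp_bound.hessian_newtonNearPotential_half` with the proved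
`stein1970_hessian_Lp_bound_holds_fin3`); Fatou along `r = 2(n + |R| + 2)`.
[cite: Stein1971, Ch. III §1.3 Prop 3] -/
theorem exists_eLpNorm_hessian_newtonPotential_le {p : ℝ≥0∞} (hp : 1 < p) (hp' : p < ⊤) :
    ∃ C : ℝ≥0, ∀ g : (EuclideanSpace ℝ (Fin 3)) → ℝ, ContDiff ℝ ∞ g → HasCompactSupport g →
      ∀ a b : EuclideanSpace ℝ (Fin 3), ‖a‖ ≤ 1 → ‖b‖ ≤ 1 →
        eLpNorm (fun x => fderiv ℝ (fun y => fderiv ℝ (g ⋆[lsmul ℝ ℝ, volume] newtonKernel) y a)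
          x b) p volume ≤ C * eLpNorm g p volume := by
  obtain ⟨C, hC⟩ := stein1970_hessian_Lp_bound_holds_fin3.hessian_newtonNearPotential_half hp hp'
  refine ⟨C, fun g hg hgc a b ha hb => ?_⟩
  have hg2 : ContDiff ℝ 2 g := contDiff_infty.1 hg 2
  obtain ⟨R, hR⟩ : ∃ R : ℝ, tsupport g ⊆ closedBall (0 : EuclideanSpace ℝ (Fin 3)) R :=
    (hgc.isCompact.isBounded).subset_closedBall 0
  -- the truncation radii `r n = 2 (n + |R| + 2)` and the truncated Hessians
  set r : ℕ → ℝ := fun n => 2 * ((n : ℝ) + |R| + 2) with hr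
  have hrpos : ∀ n, 0 < r n := fun n => by rw [hr]; positivity
  set f : ℕ → (EuclideanSpace ℝ (Fin 3)) → ℝ := fun n x =>
    fderiv ℝ (fun y => fderiv ℝ (newtonNearPotential (r n / 2) (r n) g) y a) x b with hf
  set F : (EuclideanSpace ℝ (Fin 3)) → ℝ := fun x =>
    fderiv ℝ (fun y => fderiv ℝ (g ⋆[lsmul ℝ ℝ, volume] newtonKernel) y a) x b with hF
  -- each truncated Hessian is continuous and obeys the uniform bound
  have hfm : ∀ n, AEStronglyMeasurable (f n) volume := fun n => by
    have h2 : ContDiff ℝ 2 (newtonNearPotential (r n / 2) (r n) g) :=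
      contDiff_newtonNearPotential (by positivity) (by linarith [hrpos n]) 2 hg2
    exact (continuous_fderiv_fderiv_apply h2 a b).aestronglyMeasurable
  have hfb : ∀ n, eLpNorm (f n) p volume ≤ C * eLpNorm g p volume := fun n =>
    hC (hrpos n) hg2 hgc a b ha hb
  -- pointwise, the truncated Hessians are eventually the full one
  have hlim : ∀ x, Tendsto (fun n => f n x) atTop (𝓝 (F x)) := by
    intro x
    obtain ⟨N, hN⟩ := exists_nat_ge ‖x‖
    have hev : ∀ᶠ n in atTop, f n x = F x := by
      filter_upwards [eventually_ge_atTop N] with n hn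
      have hn' : (N : ℝ) ≤ n := by exact_mod_cast hn
      have hrx : ‖x‖ + |R| + 1 ≤ r n / 2 := by
        have e : r n = 2 * ((n : ℝ) + |R| + 2) := rfl
        rw [e]; linarith
      have h₀ : 0 ≤ r n / 2 := by linarith [hrpos n]
      have h₁ : r n / 2 < r n := by linarith [hrpos n]
      have heq : (g ⋆[lsmul ℝ ℝ, volume] newtonKernel) =ᶠ[𝓝 x]
          newtonNearPotential (r n / 2) (r n) g := by
        filter_upwards [isOpen_ball.mem_nhds (mem_ball_self zero_lt_one)] with y hy
        exact convolution_newtonKernel_eq_newtonNearPotential hgc hR h₀ h₁ x hrx hy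
      simp only [hf, hF]
      exact (fderiv_fderiv_apply_congr_of_eventuallyEq' heq a b).symm
    exact tendsto_const_nhds.congr' (hev.mono fun n hn => hn.symm)
  -- Fatou
  calc eLpNorm F p volume ≤ atTop.liminf fun n => eLpNorm (f n) p volume :=
        Lp.eLpNorm_lim_le_liminf_eLpNorm hfm F (Eventually.of_forall hlim)
    _ ≤ C * eLpNorm g p volume :=
        liminf_le_of_frequently_le' (Frequently.of_forall hfb)

end HessianNewton

/-! ### §2 `∇Δ⁻¹div` is bounded on `L^p` on test fields -/

section GradientDivPotential

variable {G : (EuclideanSpace ℝ (Fin 3)) → (EuclideanSpace ℝ (Fin 3))}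

/-- The divergence of a compactly supported field is compactly supported. [folklore] -/
theorem hasCompactSupport_divergence (hGc : HasCompactSupport G) :
    HasCompactSupport (VectorCalculus.divergence G) :=
  hGc.mono' fun x hx => by
    contrapose! hx
    exact notMem_support.2 (divergence_eq_zero_of_notMem_tsupport hx)

/-- The norm of a vector is at most the sum of the absolute values of its coordinates in an
orthonormal basis. [folklore] -/
theorem norm_le_sum_abs_inner' {ι : Type*} [Fintype ι]
    (b : OrthonormalBasis ι ℝ (EuclideanSpace ℝ (Fin 3))) (v : EuclideanSpace ℝ (Fin 3)) :
    ‖v‖ ≤ ∑ k, |⟪b k, v⟫| := by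
  conv_lhs => rw [← b.sum_repr' v]
  refine (norm_sum_le _ _).trans (le_of_eq (Finset.sum_congr rfl fun k _ => ?_))
  rw [norm_smul, b.orthonormal.1 k, mul_one, Real.norm_eq_abs]

/-- The coordinate `Gⱼ = ⟪G, c⟫` of a smooth field is smooth. [folklore] -/
theorem contDiff_inner_const (hG : ContDiff ℝ ∞ G) (c : EuclideanSpace ℝ (Fin 3)) :
    ContDiff ℝ ∞ fun s => ⟪G s, c⟫ :=
  hG.inner ℝ contDiff_const

/-- The coordinate `⟪G, c⟫` of a compactly supported field is compactly supported. [folklore] -/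
theorem hasCompactSupport_inner_const (hGc : HasCompactSupport G) (c : EuclideanSpace ℝ (Fin 3)) :
    HasCompactSupport fun s => ⟪G s, c⟫ :=
  hGc.mono' fun x hx => by
    contrapose! hx
    simp [image_eq_zero_of_notMem_tsupport hx]

/-- `∂ᵥ⟪G, c⟫ = ⟪∂ᵥG, c⟫`. [folklore] -/
theorem fderiv_inner_const_apply (hG : ContDiff ℝ ∞ G) (c s v : EuclideanSpace ℝ (Fin 3)) :
    fderiv ℝ (fun s => ⟪G s, c⟫) s v = ⟪fderiv ℝ G s v, c⟫ := by
  have hd : DifferentiableAt ℝ G s := (hG.differentiable (by simp)) s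
  rw [fderiv_inner_apply ℝ hd (differentiableAt_const c)]
  simp [fderiv_const_apply]

/-- **The divergence in coordinates**: `div G = Σⱼ ∂ⱼGⱼ`, `Gⱼ = ⟪G, bⱼ⟫`, for an orthonormal basis
`b`. [folklore] -/
theorem divergence_eq_sum_fderiv_inner (hG : ContDiff ℝ ∞ G) {ι : Type*} [Fintype ι]
    (b : OrthonormalBasis ι ℝ (EuclideanSpace ℝ (Fin 3))) (s : EuclideanSpace ℝ (Fin 3)) :
    VectorCalculus.divergence G s = ∑ j, fderiv ℝ (fun s => ⟪G s, b j⟫) s (b j) := by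
  rw [divergence_eq_sum_inner_fderiv b]
  refine Finset.sum_congr rfl fun j _ => ?_
  rw [fderiv_inner_const_apply hG, real_inner_comm]

/-- The Newtonian potential of a finite sum of continuous compactly supported sources is the sum
of the potentials (pointwise). [folklore] -/
theorem convolution_newtonKernel_sum_apply {ι : Type*} (s : Finset ι)
    {h : ι → (EuclideanSpace ℝ (Fin 3)) → ℝ} (hh : ∀ j ∈ s, Continuous (h j))
    (hhc : ∀ j ∈ s, HasCompactSupport (h j)) (y : EuclideanSpace ℝ (Fin 3)) :
    ((fun t => ∑ j ∈ s, h j t) ⋆[lsmul ℝ ℝ, volume] newtonKernel) y =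
      ∑ j ∈ s, (h j ⋆[lsmul ℝ ℝ, volume] newtonKernel) y := by
  rw [convolution_newtonKernel_apply']
  simp_rw [convolution_newtonKernel_apply', Finset.mul_sum]
  exact integral_finsetSum s fun j hj => integrable_newtonKernel_mul (hh j hj) (hhc j hj) y

/-- **`∂ᵢπ[G] = Σⱼ ∂ᵢ∂ⱼ(Gⱼ ⋆ Γ)`**: the directional derivative of `π[G] = (div G) ⋆ Γ` along `v` is
the sum over an orthonormal basis of the mixed Hessians of the potentials of the coordinates
(derivatives fall on the test sources, `fderiv_convolution_newtonKernel_apply`). [folklore] -/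
theorem fderiv_divPotential_eq_sum (hG : ContDiff ℝ ∞ G) (hGc : HasCompactSupport G)
    {ι : Type*} [Fintype ι] (b : OrthonormalBasis ι ℝ (EuclideanSpace ℝ (Fin 3)))
    (y v : EuclideanSpace ℝ (Fin 3)) :
    fderiv ℝ (divPotential G) y v =
      ∑ j, fderiv ℝ (fun s => fderiv ℝ ((fun s => ⟪G s, b j⟫) ⋆[lsmul ℝ ℝ, volume] newtonKernel)
        s (b j)) y v := by
  have hdiv : ContDiff ℝ ∞ (VectorCalculus.divergence G) := contDiff_divergence_of_contDiff_top hG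
  have hdivc : HasCompactSupport (VectorCalculus.divergence G) := hasCompactSupport_divergence hGc
  -- `∂ᵥπ[G] = (∂ᵥ div G) ⋆ Γ`
  rw [divPotential, fderiv_convolution_newtonKernel_apply (hdiv.of_le (by norm_cast)) hdivc y v]
  -- `∂ᵥ div G = Σⱼ ∂ᵥ∂ⱼGⱼ`
  have hGj : ∀ j, ContDiff ℝ ∞ fun s => ⟪G s, b j⟫ := fun j => contDiff_inner_const hG (b j)
  have hGjc : ∀ j, HasCompactSupport fun s => ⟪G s, b j⟫ := fun j =>
    hasCompactSupport_inner_const hGc (b j)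
  have hDj : ∀ j, ContDiff ℝ ∞ fun s => fderiv ℝ (fun s => ⟪G s, b j⟫) s (b j) := fun j =>
    ((hGj j).fderiv_right (m := ∞) le_rfl).clm_apply contDiff_const
  have hDjc : ∀ j, HasCompactSupport fun s => fderiv ℝ (fun s => ⟪G s, b j⟫) s (b j) := fun j =>
    (hGjc j).fderiv_apply (𝕜 := ℝ) (b j)
  have hsum : (fun t => fderiv ℝ (VectorCalculus.divergence G) t v) =
      fun t => ∑ j, fderiv ℝ (fun s => fderiv ℝ (fun s => ⟪G s, b j⟫) s (b j)) t v := by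
    funext t
    have e : VectorCalculus.divergence G = fun s => ∑ j, fderiv ℝ (fun s => ⟪G s, b j⟫) s (b j) :=
      funext fun s => divergence_eq_sum_fderiv_inner hG b s
    rw [e, fderiv_fun_sum fun j _ => ((hDj j).differentiable (by simp)) t]
    simp
  rw [hsum]
  -- the potential of the sum is the sum of the potentials
  have hDjv : ∀ j, Continuous fun t => fderiv ℝ (fun s => fderiv ℝ (fun s => ⟪G s, b j⟫) s (b j)) t v :=
    fun j => (((hDj j).fderiv_right (m := ∞) le_rfl).clm_apply contDiff_const).continuous
  have hDjvc : ∀ j, HasCompactSupport fun t =>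
      fderiv ℝ (fun s => fderiv ℝ (fun s => ⟪G s, b j⟫) s (b j)) t v :=
    fun j => (hDjc j).fderiv_apply (𝕜 := ℝ) v
  rw [convolution_newtonKernel_sum_apply Finset.univ (fun j _ => hDjv j) (fun j _ => hDjvc j)]
  refine Finset.sum_congr rfl fun j _ => ?_
  -- `(∂ᵥ∂ⱼGⱼ) ⋆ Γ = ∂ᵥ∂ⱼ(Gⱼ ⋆ Γ)`
  have e1 : (fun s => fderiv ℝ ((fun s => ⟪G s, b j⟫) ⋆[lsmul ℝ ℝ, volume] newtonKernel) s (b j)) =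
      ((fun t => fderiv ℝ (fun s => ⟪G s, b j⟫) t (b j)) ⋆[lsmul ℝ ℝ, volume] newtonKernel) :=
    funext fun s => fderiv_convolution_newtonKernel_apply ((hGj j).of_le (by norm_cast)) (hGjc j) s _
  rw [e1, fderiv_convolution_newtonKernel_apply ((hDj j).of_le (by norm_cast)) (hDjc j) y v]

/-- **`∇Δ⁻¹div` is bounded on `L^p(ℝ³)` on test fields**, `1 < p < ∞` (Calderón 1990, §1: the
Leray projector `P = Id − ∇Δ⁻¹div` is bounded on `L^p`; Stein Prop. III.3): there is `C = C(p)`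
with `∇π[G] ∈ L^p` and `‖∇π[G]‖_{L^p} ≤ C ‖G‖_{L^p}` for every `G ∈ C_c^∞(ℝ³; ℝ³)`,
`π[G] = (div G) ⋆ Γ = Δ⁻¹ div G` (`divPotential`). Proof: `⟪∇π, bᵢ⟫ = Σⱼ ∂ᵢ∂ⱼ(Gⱼ ⋆ Γ)`
(`fderiv_divPotential_eq_sum`), §1, and `‖∇π(x)‖ ≤ Σᵢ |⟪∇π(x), bᵢ⟫|`. [cite: Calderon1990, §1] -/
theorem exists_eLpNorm_gradient_divPotential_le {p : ℝ≥0∞} (hp : 1 < p) (hp' : p < ⊤) :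
    ∃ C : ℝ≥0, ∀ G : (EuclideanSpace ℝ (Fin 3)) → (EuclideanSpace ℝ (Fin 3)), ContDiff ℝ ∞ G →
      HasCompactSupport G →
      MemLp (fun x => gradient (divPotential G) x) p volume ∧
      eLpNorm (fun x => gradient (divPotential G) x) p volume ≤ C * eLpNorm G p volume := by
  obtain ⟨C, hC⟩ := exists_eLpNorm_hessian_newtonPotential_le hp hp'
  refine ⟨9 * C, fun G hG hGc => ?_⟩
  set b := stdOrthonormalBasis ℝ (EuclideanSpace ℝ (Fin 3)) with hb
  have hcard : Fintype.card (Fin (Module.finrank ℝ (EuclideanSpace ℝ (Fin 3)))) = 3 := by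
    rw [Fintype.card_fin, finrank_euclideanSpace_fin]
  have hπ : ContDiff ℝ ∞ (divPotential G) := contDiff_divPotential hG hGc
  have hgradc : Continuous fun x => gradient (divPotential G) x :=
    (contDiff_gradient_of_contDiff_top hπ).continuous
  have hGm : AEStronglyMeasurable G volume := hG.continuous.aestronglyMeasurable
  -- coordinates
  have hGj : ∀ j, ContDiff ℝ ∞ fun s => ⟪G s, b j⟫ := fun j => contDiff_inner_const hG (b j)
  have hGjc : ∀ j, HasCompactSupport fun s => ⟪G s, b j⟫ := fun j =>
    hasCompactSupport_inner_const hGc (b j)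
  have hGj_le : ∀ j, eLpNorm (fun s => ⟪G s, b j⟫) p volume ≤ eLpNorm G p volume := fun j =>
    eLpNorm_mono fun s => by
      rw [Real.norm_eq_abs]
      calc |⟪G s, b j⟫| ≤ ‖G s‖ * ‖b j‖ := abs_real_inner_le_norm _ _
        _ = ‖G s‖ := by rw [b.orthonormal.1 j, mul_one]
  -- the mixed Hessians `Hᵢⱼ = ∂ᵢ∂ⱼ(Gⱼ ⋆ Γ)`
  set H : Fin (Module.finrank ℝ (EuclideanSpace ℝ (Fin 3))) →
      Fin (Module.finrank ℝ (EuclideanSpace ℝ (Fin 3))) → (EuclideanSpace ℝ (Fin 3)) → ℝ :=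
    fun i j x => fderiv ℝ (fun s => fderiv ℝ ((fun s => ⟪G s, b j⟫) ⋆[lsmul ℝ ℝ, volume]
      newtonKernel) s (b j)) x (b i) with hH
  have hHb : ∀ i j, eLpNorm (H i j) p volume ≤ C * eLpNorm G p volume := fun i j =>
    (hC _ (hGj j) (hGjc j) (b j) (b i) (b.orthonormal.1 j).le (b.orthonormal.1 i).le).trans
      (mul_le_mul_right (hGj_le j) _)
  have hHm : ∀ i j, AEStronglyMeasurable (H i j) volume := fun i j => by
    have h2 : ContDiff ℝ 2 ((fun s => ⟪G s, b j⟫) ⋆[lsmul ℝ ℝ, volume] newtonKernel) :=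
      contDiff_infty.1 (contDiff_convolution_newtonKernel (hGj j) (hGjc j)) 2
    exact (continuous_fderiv_fderiv_apply h2 (b j) (b i)).aestronglyMeasurable
  -- `⟪∇π(x), bᵢ⟫ = Σⱼ Hᵢⱼ(x)`
  have hcoord : ∀ x i, ⟪b i, gradient (divPotential G) x⟫ = ∑ j, H i j x := fun x i => by
    rw [inner_gradient_eq_fderiv_apply, fderiv_divPotential_eq_sum hG hGc b x (b i)]
  -- pointwise domination `‖∇π(x)‖ ≤ Σᵢ ‖Σⱼ Hᵢⱼ(x)‖`
  have hdom : ∀ x, ‖gradient (divPotential G) x‖ ≤ ∑ i, ‖(∑ j, H i j) x‖ := fun x => by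
    calc ‖gradient (divPotential G) x‖ ≤ ∑ i, |⟪b i, gradient (divPotential G) x⟫| :=
          norm_le_sum_abs_inner' b _
      _ = ∑ i, ‖(∑ j, H i j) x‖ := by
          refine Finset.sum_congr rfl fun i _ => ?_
          rw [hcoord, Real.norm_eq_abs, Finset.sum_apply]
  have hSm : ∀ i, AEStronglyMeasurable (∑ j, H i j) volume := fun i =>
    Finset.aestronglyMeasurable_sum _ fun j _ => hHm i j
  have hbound : eLpNorm (fun x => gradient (divPotential G) x) p volume ≤
      (9 * C : ℝ≥0) * eLpNorm G p volume := by
    calc eLpNorm (fun x => gradient (divPotential G) x) p volume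
        ≤ eLpNorm (fun x => ∑ i, ‖(∑ j, H i j) x‖) p volume := eLpNorm_mono_real hdom
      _ = eLpNorm (∑ i, fun x => ‖(∑ j, H i j) x‖) p volume := by
          congr 1; funext x; simp only [Finset.sum_apply]
      _ ≤ ∑ i, eLpNorm (fun x => ‖(∑ j, H i j) x‖) p volume :=
          eLpNorm_sum_le (fun i _ => (hSm i).norm) hp.le
      _ = ∑ i, eLpNorm (∑ j, H i j) p volume := by
          refine Finset.sum_congr rfl fun i _ => ?_
          exact eLpNorm_norm (∑ j, H i j)
      _ ≤ ∑ i, ∑ j, eLpNorm (H i j) p volume := by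
          gcongr with i _
          exact eLpNorm_sum_le (fun j _ => hHm i j) hp.le
      _ ≤ ∑ _i : Fin (Module.finrank ℝ (EuclideanSpace ℝ (Fin 3))),
            ∑ _j : Fin (Module.finrank ℝ (EuclideanSpace ℝ (Fin 3))), (C : ℝ≥0∞) * eLpNorm G p volume := by
          gcongr with i _ j _
          exact hHb i j
      _ = (9 * C : ℝ≥0) * eLpNorm G p volume := by
          rw [Finset.sum_const, Finset.sum_const, Finset.card_univ, hcard]
          push_cast
          ring
  refine ⟨⟨hgradc.aestronglyMeasurable, ?_⟩, hbound⟩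
  refine hbound.trans_lt (ENNReal.mul_lt_top ENNReal.coe_lt_top ?_)
  exact (hG.continuous.memLp_of_hasCompactSupport (μ := volume) hGc).eLpNorm_lt_top

end GradientDivPotential


/-! ### §3 Smallness of `∇π[χ_ρ a]` for a divergence-free `a ∈ L^p` -/

section Tools

/-- **Hölder on a ball**: for `1 ≤ q < ∞` and `f ∈ L^q`,
`∫_{B̄(x₀,r)} ‖f‖ ≤ |B̄(x₀,r)|^{1 − 1/q} ‖f‖_{L^q}`. [folklore] -/
theorem setIntegral_norm_le_of_memLp {F' : Type*} [NormedAddCommGroup F']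
    {f : (EuclideanSpace ℝ (Fin 3)) → F'} {q : ℝ≥0∞} (hq1 : 1 ≤ q) (hq : q ≠ ⊤)
    (hf : MemLp f q volume) (x₀ : (EuclideanSpace ℝ (Fin 3))) (r : ℝ) :
    ∫ y in closedBall x₀ r, ‖f y‖ ≤
      ((volume : Measure (EuclideanSpace ℝ (Fin 3))).real (closedBall x₀ r)) ^ (1 - 1 / q.toReal) *
        (eLpNorm f q volume).toReal := by
  set B := closedBall x₀ r with hB
  have hBfin : volume B < ⊤ := measure_closedBall_lt_top
  have hm : AEStronglyMeasurable f (volume.restrict B) := hf.1.restrict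
  have h1 : eLpNorm f 1 (volume.restrict B) ≤
      eLpNorm f q (volume.restrict B) * (volume.restrict B) univ ^ (1 - 1 / q.toReal) := by
    have h := eLpNorm_le_eLpNorm_mul_rpow_measure_univ (p := 1) (q := q) hq1 hm
    have he : 1 / (1 : ℝ≥0∞).toReal - 1 / q.toReal = 1 - 1 / q.toReal := by
      rw [ENNReal.toReal_one, div_one]
    rwa [he] at h
  rw [Measure.restrict_apply_univ] at h1
  have h2 : eLpNorm f 1 (volume.restrict B) ≤ eLpNorm f q volume * volume B ^ (1 - 1 / q.toReal) :=
    h1.trans (mul_le_mul' (eLpNorm_restrict_le _ _ _ _) le_rfl)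
  have hexp : 0 ≤ 1 - 1 / q.toReal := by
    rw [sub_nonneg, div_le_one (ENNReal.toReal_pos (zero_lt_one.trans_le hq1).ne' hq)]
    have := (ENNReal.toReal_le_toReal ENNReal.one_ne_top hq).2 hq1
    rwa [ENNReal.toReal_one] at this
  have hne : eLpNorm f q volume * volume B ^ (1 - 1 / q.toReal) ≠ ⊤ :=
    ENNReal.mul_ne_top hf.eLpNorm_ne_top (ENNReal.rpow_ne_top_of_nonneg hexp hBfin.ne)
  have h3 := ENNReal.toReal_mono hne h2
  rw [eLpNorm_one_eq_lintegral_enorm, ENNReal.toReal_mul, ← ENNReal.toReal_rpow] at h3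
  have e : ∫ y in B, ‖f y‖ = (∫⁻ y in B, ‖f y‖ₑ).toReal := integral_norm_eq_lintegral_enorm hm
  rw [e, measureReal_def, mul_comm]
  exact h3

/-- **Integrals against kernels supported in a ball.** If `‖F‖ ≤ κ H` pointwise, `F` vanishes off
`B̄(x₀, r)` and `H` is integrable on that ball, then
`‖∫ F‖ ≤ κ ∫_{B̄(x₀,r)} H`. [folklore] -/
theorem norm_integral_le_of_kernel_bound {F' : Type*} [NormedAddCommGroup F'] [NormedSpace ℝ F']
    {F : (EuclideanSpace ℝ (Fin 3)) → F'} {H : (EuclideanSpace ℝ (Fin 3)) → ℝ}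
    {x₀ : (EuclideanSpace ℝ (Fin 3))} {κ r : ℝ}
    (hHi : IntegrableOn H (closedBall x₀ r) volume)
    (hF : ∀ y, ‖F y‖ ≤ κ * H y) (hF0 : ∀ y, r < dist y x₀ → F y = 0) :
    ‖∫ y, F y‖ ≤ κ * ∫ y in closedBall x₀ r, H y := by
  set B := closedBall x₀ r with hB
  have hBm : MeasurableSet B := measurableSet_closedBall
  set G : (EuclideanSpace ℝ (Fin 3)) → ℝ := B.indicator fun y => κ * H y with hG
  have hHi' : IntegrableOn (fun y => κ * H y) B volume := hHi.const_mul κ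
  have hGi : Integrable G := hHi'.integrable_indicator hBm
  have hle : ∀ y, ‖F y‖ ≤ G y := fun y => by
    by_cases hy : y ∈ B
    · rw [hG, indicator_of_mem hy]; exact hF y
    · have hy' : r < dist y x₀ := by rwa [hB, mem_closedBall, not_le] at hy
      rw [hG, indicator_of_notMem hy, hF0 y hy', norm_zero]
  calc ‖∫ y, F y‖ ≤ ∫ y, G y := norm_integral_le_of_norm_le hGi (Eventually.of_forall hle)
    _ = κ * ∫ y in B, H y := by rw [hG, integral_indicator hBm, integral_const_mul]

/-- The cut-off is continuous. [folklore] -/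
theorem continuous_cutoff (R : ℝ) : Continuous (cutoff (E := EuclideanSpace ℝ (Fin 3)) R) :=
  (contDiff_cutoff (E := EuclideanSpace ℝ (Fin 3)) (n := 0) R).continuous

/-- `‖∇θ(x)‖ = ‖Dθ(x)‖`. [folklore] -/
theorem norm_gradient_eq_norm_fderiv (θ : (EuclideanSpace ℝ (Fin 3)) → ℝ)
    (x : EuclideanSpace ℝ (Fin 3)) : ‖gradient θ x‖ = ‖fderiv ℝ θ x‖ := by
  rw [gradient, LinearIsometryEquiv.norm_map]

/-- Additivity of `π[·]` on test fields: `π[G₁ + G₂] = π[G₁] + π[G₂]`. [folklore] -/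
theorem divPotential_add {G₁ G₂ : (EuclideanSpace ℝ (Fin 3)) → (EuclideanSpace ℝ (Fin 3))}
    (h₁ : ContDiff ℝ ∞ G₁) (h₁c : HasCompactSupport G₁) (h₂ : ContDiff ℝ ∞ G₂)
    (h₂c : HasCompactSupport G₂) :
    divPotential (fun y => G₁ y + G₂ y) = fun x => divPotential G₁ x + divPotential G₂ x := by
  funext x
  rw [divPotential_apply, divPotential_apply, divPotential_apply,
    ← integral_add (integrable_newtonKernel_mul (contDiff_divergence_of_contDiff_top h₁).continuous
      (hasCompactSupport_divergence h₁c) x)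
      (integrable_newtonKernel_mul (contDiff_divergence_of_contDiff_top h₂).continuous
      (hasCompactSupport_divergence h₂c) x)]
  refine integral_congr_ae (Eventually.of_forall fun t => ?_)
  show newtonKernel (x - t) * VectorCalculus.divergence (fun y => G₁ y + G₂ y) t =
    newtonKernel (x - t) * VectorCalculus.divergence G₁ t +
      newtonKernel (x - t) * VectorCalculus.divergence G₂ t
  rw [divergence_add_apply ((h₁.differentiable (by simp)) t) ((h₂.differentiable (by simp)) t)]
  ring

/-- Additivity of the gradient for differentiable functions. [folklore] -/
theorem gradient_add_apply' {f₁ f₂ : (EuclideanSpace ℝ (Fin 3)) → ℝ} {x : EuclideanSpace ℝ (Fin 3)}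
    (h₁ : DifferentiableAt ℝ f₁ x) (h₂ : DifferentiableAt ℝ f₂ x) :
    gradient (fun y => f₁ y + f₂ y) x = gradient f₁ x + gradient f₂ x := by
  simp only [gradient]
  rw [fderiv_fun_add h₁ h₂, map_add]

end Tools

section Smallness

variable {a : (EuclideanSpace ℝ (Fin 3)) → (EuclideanSpace ℝ (Fin 3))}

/-- The cut-off field `χ_R a` is smooth. [folklore] -/
theorem contDiff_cutoff_smul (ha : ContDiff ℝ ∞ a) (R : ℝ) :
    ContDiff ℝ ∞ fun y => cutoff R y • a y :=
  (contDiff_cutoff (E := EuclideanSpace ℝ (Fin 3)) R).smul ha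

/-- The cut-off field `χ_R a` has compact support (`R > 0`). [folklore] -/
theorem hasCompactSupport_cutoff_smul (a : (EuclideanSpace ℝ (Fin 3)) → (EuclideanSpace ℝ (Fin 3)))
    {R : ℝ} (hR : 0 < R) : HasCompactSupport fun y => cutoff R y • a y :=
  (hasCompactSupport_cutoff (E := EuclideanSpace ℝ (Fin 3)) hR).smul_right

/-- **The source of `π[χ_R a]`**: for divergence-free `a`, `div(χ_R a) = ⟪a, ∇χ_R⟫`. [folklore] -/
theorem divergence_cutoff_smul (ha : ContDiff ℝ ∞ a) (hdiv : VectorCalculus.IsDivFree a) (R : ℝ)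
    (t : EuclideanSpace ℝ (Fin 3)) :
    VectorCalculus.divergence (fun y => cutoff R y • a y) t = ⟪a t, gradient (cutoff R) t⟫ := by
  rw [divergence_smul_apply (((contDiff_cutoff (E := EuclideanSpace ℝ (Fin 3)) (n := 1) R).differentiable one_ne_zero) t)
    ((ha.differentiable (by simp)) t), hdiv t, mul_zero, zero_add]

/-- The source `div(χ_R a)` is `O(R⁻¹|a|)`: `|div(χ_R a)(t)| ≤ (C₁/R) ‖a(t)‖` for the gradient
bound `‖Dχ_R‖ ≤ C₁/R` of `exists_norm_fderiv_cutoff_le`. [folklore] -/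
theorem abs_divergence_cutoff_smul_le (ha : ContDiff ℝ ∞ a) (hdiv : VectorCalculus.IsDivFree a)
    {C₁ : ℝ} (hC₁ : ∀ R : ℝ, 0 < R → ∀ x : EuclideanSpace ℝ (Fin 3), ‖fderiv ℝ (cutoff R) x‖ ≤ C₁ / R)
    {R : ℝ} (hR : 0 < R) (t : EuclideanSpace ℝ (Fin 3)) :
    |VectorCalculus.divergence (fun y => cutoff R y • a y) t| ≤ C₁ / R * ‖a t‖ := by
  rw [divergence_cutoff_smul ha hdiv]
  calc |⟪a t, gradient (cutoff R) t⟫| ≤ ‖a t‖ * ‖gradient (cutoff R) t‖ := abs_real_inner_le_norm _ _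
    _ = ‖a t‖ * ‖fderiv ℝ (cutoff R) t‖ := by rw [norm_gradient_eq_norm_fderiv]
    _ ≤ ‖a t‖ * (C₁ / R) := mul_le_mul_of_nonneg_left (hC₁ R hR t) (norm_nonneg _)
    _ = C₁ / R * ‖a t‖ := mul_comm _ _

/-- The source `div(χ_R a)` vanishes off the shell `R ≤ ‖t‖ ≤ 2R`. [folklore] -/
theorem divergence_cutoff_smul_eq_zero (ha : ContDiff ℝ ∞ a) (hdiv : VectorCalculus.IsDivFree a)
    {R : ℝ} (hR : 0 < R) {t : EuclideanSpace ℝ (Fin 3)} (ht : ‖t‖ < R ∨ 2 * R < ‖t‖) :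
    VectorCalculus.divergence (fun y => cutoff R y • a y) t = 0 := by
  rw [divergence_cutoff_smul ha hdiv]
  -- the cut-off is locally constant off the shell, so its derivative vanishes there
  have hD : fderiv ℝ (cutoff R) t = 0 := by
    rcases ht with h | h
    · have hloc : cutoff (E := EuclideanSpace ℝ (Fin 3)) R =ᶠ[𝓝 t] fun _ => (1 : ℝ) := by
        filter_upwards [(isOpen_lt continuous_norm continuous_const).mem_nhds h] with y hy
        exact cutoff_eq_one hR (le_of_lt hy)
      rw [hloc.fderiv_eq, fderiv_fun_const]
      rfl
    · have hloc : cutoff (E := EuclideanSpace ℝ (Fin 3)) R =ᶠ[𝓝 t] fun _ => (0 : ℝ) := by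
        filter_upwards [(isOpen_lt continuous_const continuous_norm).mem_nhds h] with y hy
        exact cutoff_eq_zero hR (le_of_lt hy)
      rw [hloc.fderiv_eq, fderiv_fun_const]
      rfl
  rw [gradient, hD, map_zero, inner_zero_right]

/-- The source `div(χ_R a)` is supported in the closed shell, hence so is its derivative: for
`‖t‖ < R` or `‖t‖ > 2R`, `∂ᵥ div(χ_R a)(t) = 0`. [folklore] -/
theorem fderiv_divergence_cutoff_smul_eq_zero (ha : ContDiff ℝ ∞ a) (hdiv : VectorCalculus.IsDivFree a)
    {R : ℝ} (hR : 0 < R) {t : EuclideanSpace ℝ (Fin 3)} (ht : ‖t‖ < R ∨ 2 * R < ‖t‖)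
    (v : EuclideanSpace ℝ (Fin 3)) :
    fderiv ℝ (VectorCalculus.divergence fun y => cutoff R y • a y) t v = 0 := by
  have h : (VectorCalculus.divergence fun y => cutoff R y • a y) =ᶠ[𝓝 t] fun _ => (0 : ℝ) := by
    rcases ht with h | h
    · filter_upwards [(isOpen_lt continuous_norm continuous_const).mem_nhds h] with y hy
      exact divergence_cutoff_smul_eq_zero ha hdiv hR (Or.inl hy)
    · filter_upwards [(isOpen_lt continuous_const continuous_norm).mem_nhds h] with y hy
      exact divergence_cutoff_smul_eq_zero ha hdiv hR (Or.inr hy)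
  rw [h.fderiv_eq, fderiv_fun_const]
  rfl

/-- **Pointwise decay of `∇π[χ_R a](x)` as `R → ∞`.** For a smooth divergence-free `a ∈ L^p`,
`1 ≤ p < ∞`, a centre `x`, a direction `v` and a radius `R ≥ 2‖x‖ + 2`:
`|∂ᵥπ[χ_R a](x)| ≤ ‖v‖ (πR²)⁻¹ (C₁/R) |B̄(0,2R)|^{1−1/p} ‖a‖_{L^p}` — the source `⟪a, ∇χ_R⟫` lives on
the shell `R ≤ ‖t‖ ≤ 2R`, at distance `≥ R/2` from `x`, where the kernel gradient is `≤ (πR²)⁻¹`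
(one integration by parts off the singularity, `Γ = Φ₁` there), and `∫_{shell} |a| ≤` Hölder. [folklore] -/
theorem abs_fderiv_divPotential_cutoff_smul_le (ha : ContDiff ℝ ∞ a) {p : ℝ≥0∞} (hp1 : 1 ≤ p)
    (hp : p ≠ ⊤) (haLp : MemLp a p volume) (hdiv : VectorCalculus.IsDivFree a)
    {C₁ : ℝ} (hC₁ : ∀ R : ℝ, 0 < R → ∀ x : EuclideanSpace ℝ (Fin 3), ‖fderiv ℝ (cutoff R) x‖ ≤ C₁ / R)
    (x v : EuclideanSpace ℝ (Fin 3)) {R : ℝ} (hR : 2 * ‖x‖ + 2 ≤ R) :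
    |fderiv ℝ (divPotential fun y => cutoff R y • a y) x v| ≤
      ‖v‖ * (Real.pi * R ^ 2)⁻¹ * (C₁ / R) *
        (((volume : Measure (EuclideanSpace ℝ (Fin 3))).real
          (closedBall (0 : EuclideanSpace ℝ (Fin 3)) (2 * R))) ^ (1 - 1 / p.toReal) *
          (eLpNorm a p volume).toReal) := by
  have hR0 : 0 < R := by linarith [norm_nonneg x]
  have hC₁0 : 0 ≤ C₁ := by
    have h := hC₁ 1 one_pos 0
    rw [div_one] at h
    exact (norm_nonneg _).trans h
  set A : (EuclideanSpace ℝ (Fin 3)) → (EuclideanSpace ℝ (Fin 3)) := fun y => cutoff R y • a y with hA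
  have hAs : ContDiff ℝ ∞ A := contDiff_cutoff_smul ha R
  have hAc : HasCompactSupport A := hasCompactSupport_cutoff_smul a hR0
  set σ : (EuclideanSpace ℝ (Fin 3)) → ℝ := VectorCalculus.divergence A with hσ
  have hσs : ContDiff ℝ ∞ σ := contDiff_divergence_of_contDiff_top hAs
  have hσc : HasCompactSupport σ := hasCompactSupport_divergence hAc
  have hσ1 : ContDiff ℝ 1 σ := hσs.of_le (by norm_cast)
  -- `∂ᵥπ[A](x) = ∫ Γ(x - t) ∂ᵥσ(t) dt`
  have hderiv : fderiv ℝ (divPotential A) x v = ∫ t, newtonKernel (x - t) * fderiv ℝ σ t v := by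
    rw [divPotential, fderiv_convolution_newtonKernel_apply hσ1 hσc x v, convolution_newtonKernel_apply']
  -- on the support of `∂ᵥσ`, `Γ(x - t) = Φ₁(x - t)`
  have hfar : ∀ t, fderiv ℝ σ t v ≠ 0 → R ≤ ‖t‖ ∧ ‖t‖ ≤ 2 * R := by
    intro t ht
    by_contra hcon
    rw [not_and_or, not_le, not_le] at hcon
    exact ht (fderiv_divergence_cutoff_smul_eq_zero ha hdiv hR0 hcon v)
  have hdist : ∀ t, R ≤ ‖t‖ → R / 2 ≤ ‖x - t‖ ∧ 1 < ‖x - t‖ := by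
    intro t ht
    have h1 : ‖t‖ - ‖x‖ ≤ ‖x - t‖ := by
      have := norm_sub_norm_le t x
      rw [norm_sub_rev] at this
      linarith
    constructor <;> linarith [norm_nonneg x]
  have hreg : ∀ t, newtonKernel (x - t) * fderiv ℝ σ t v = newtonReg 1 (x - t) * fderiv ℝ σ t v := by
    intro t
    by_cases ht : fderiv ℝ σ t v = 0
    · rw [ht, mul_zero, mul_zero]
    · rw [newtonReg_eq_newtonKernel one_pos (hdist t (hfar t ht).1).2.le]
  -- integration by parts with the smooth kernel `Φ₁(x - ·)`
  set Ψ : (EuclideanSpace ℝ (Fin 3)) → ℝ := fun t => newtonReg 1 (x - t) with hΨ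
  have hΨ1 : ContDiff ℝ 1 Ψ := (contDiff_newtonReg 1 (n := 1)).comp (contDiff_const.sub contDiff_id)
  have hibp : ∫ t, newtonKernel (x - t) * fderiv ℝ σ t v = -∫ t, fderiv ℝ Ψ t v * σ t := by
    simp_rw [hreg]
    exact integral_mul_fderiv_apply_eq_neg hΨ1 hσ1 hσc v
  have hDΨ : ∀ t, fderiv ℝ Ψ t v = -fderiv ℝ (newtonReg 1) (x - t) v := fun t =>
    fderiv_comp_const_sub_apply (contDiff_newtonReg 1 (n := 1)) x t v
  -- kernel bound on the shell
  have hkernel : ∀ t, R ≤ ‖t‖ → ‖fderiv ℝ Ψ t v‖ ≤ ‖v‖ * (Real.pi * R ^ 2)⁻¹ := by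
    intro t ht
    obtain ⟨hd1, hd2⟩ := hdist t ht
    rw [hDΨ t, norm_neg]
    calc ‖fderiv ℝ (newtonReg 1) (x - t) v‖ ≤ ‖fderiv ℝ (newtonReg 1) (x - t)‖ * ‖v‖ :=
          ContinuousLinearMap.le_opNorm _ _
      _ = (4 * Real.pi * ‖x - t‖ ^ 2)⁻¹ * ‖v‖ := by rw [norm_fderiv_newtonReg one_pos hd2]
      _ ≤ (Real.pi * R ^ 2)⁻¹ * ‖v‖ := by
          refine mul_le_mul_of_nonneg_right ?_ (norm_nonneg _)
          refine inv_anti₀ (by positivity) ?_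
          have hsq : R ^ 2 ≤ 4 * ‖x - t‖ ^ 2 := by nlinarith [hd1, hR0.le]
          calc Real.pi * R ^ 2 ≤ Real.pi * (4 * ‖x - t‖ ^ 2) :=
                mul_le_mul_of_nonneg_left hsq Real.pi_pos.le
            _ = 4 * Real.pi * ‖x - t‖ ^ 2 := by ring
      _ = ‖v‖ * (Real.pi * R ^ 2)⁻¹ := mul_comm _ _
  -- the bound on the integrand: `‖∂ᵥΨ σ‖ ≤ ‖v‖(πR²)⁻¹ (C₁/R) ‖a‖`, vanishing off `B̄(0, 2R)`
  have hF : ∀ t, ‖fderiv ℝ Ψ t v * σ t‖ ≤ ‖v‖ * (Real.pi * R ^ 2)⁻¹ * (C₁ / R) * ‖a t‖ := by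
    intro t
    by_cases ht : ‖t‖ < R
    · rw [show σ t = 0 from divergence_cutoff_smul_eq_zero ha hdiv hR0 (Or.inl ht), mul_zero,
        norm_zero]
      positivity
    · rw [not_lt] at ht
      rw [norm_mul, Real.norm_eq_abs]
      calc ‖fderiv ℝ Ψ t v‖ * |σ t| ≤ (‖v‖ * (Real.pi * R ^ 2)⁻¹) * (C₁ / R * ‖a t‖) :=
            mul_le_mul (hkernel t ht) (abs_divergence_cutoff_smul_le ha hdiv hC₁ hR0 t)
              (abs_nonneg _) (by positivity)
        _ = _ := by ring
  have hF0 : ∀ t, 2 * R < dist t (0 : EuclideanSpace ℝ (Fin 3)) → fderiv ℝ Ψ t v * σ t = 0 := by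
    intro t ht
    rw [dist_zero_right] at ht
    rw [show σ t = 0 from divergence_cutoff_smul_eq_zero ha hdiv hR0 (Or.inr ht), mul_zero]
  have hbound := norm_integral_le_of_kernel_bound
    (ha.continuous.norm.continuousOn.integrableOn_compact (isCompact_closedBall 0 (2 * R))) hF hF0
  rw [hderiv, hibp, abs_neg, ← Real.norm_eq_abs]
  refine hbound.trans ?_
  refine mul_le_mul_of_nonneg_left (setIntegral_norm_le_of_memLp hp1 hp haLp 0 (2 * R)) ?_
  positivity

/-- **`∇π[χ_R a](x) → 0` as `R → ∞`** along any sequence of radii tending to infinity, for a smooth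
divergence-free `a ∈ L^p`, `1 ≤ p < ∞` (the bound of `abs_fderiv_divPotential_cutoff_smul_le` is
`O(R^{-3/p})`). [folklore] -/
theorem tendsto_gradient_divPotential_cutoff_smul (ha : ContDiff ℝ ∞ a) {p : ℝ≥0∞} (hp1 : 1 ≤ p)
    (hp : p ≠ ⊤) (haLp : MemLp a p volume) (hdiv : VectorCalculus.IsDivFree a)
    {R : ℕ → ℝ} (hR : Tendsto R atTop atTop) (x : EuclideanSpace ℝ (Fin 3)) :
    Tendsto (fun n => gradient (divPotential fun y => cutoff (R n) y • a y) x) atTop (𝓝 0) := by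
  obtain ⟨C₁, hC₁0, hC₁⟩ := exists_norm_fderiv_cutoff_le (E := EuclideanSpace ℝ (Fin 3))
  set b := stdOrthonormalBasis ℝ (EuclideanSpace ℝ (Fin 3)) with hb
  set V₁ := (volume : Measure (EuclideanSpace ℝ (Fin 3))).real
    (closedBall (0 : (EuclideanSpace ℝ (Fin 3))) 1) with hV₁
  have hV₁0 : 0 ≤ V₁ := measureReal_nonneg
  set θ : ℝ := 1 - 1 / p.toReal with hθ
  have hθ0 : 0 ≤ θ := by
    rw [hθ, sub_nonneg, div_le_one (ENNReal.toReal_pos (zero_lt_one.trans_le hp1).ne' hp)]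
    have := (ENNReal.toReal_le_toReal ENNReal.one_ne_top hp).2 hp1
    rwa [ENNReal.toReal_one] at this
  have hppos : 0 < p.toReal := ENNReal.toReal_pos (zero_lt_one.trans_le hp1).ne' hp
  set N : ℝ := (eLpNorm a p volume).toReal with hN
  -- each directional derivative tends to `0`
  have hdir : ∀ v : EuclideanSpace ℝ (Fin 3),
      Tendsto (fun n => fderiv ℝ (divPotential fun y => cutoff (R n) y • a y) x v) atTop (𝓝 0) := by
    intro v
    set K : ℝ := ‖v‖ * Real.pi⁻¹ * C₁ * (8 * V₁) ^ θ * N with hK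
    have hev : ∀ᶠ n in atTop, ‖fderiv ℝ (divPotential fun y => cutoff (R n) y • a y) x v‖ ≤
        K * (R n) ^ (-(3 / p.toReal)) := by
      filter_upwards [hR.eventually_ge_atTop (2 * ‖x‖ + 2)] with n hn
      have hR0 : 0 < R n := by linarith [norm_nonneg x]
      rw [Real.norm_eq_abs]
      refine (abs_fderiv_divPotential_cutoff_smul_le ha hp1 hp haLp hdiv hC₁ x v hn).trans_eq ?_
      -- `|B̄(0,2R)|^θ = (8V₁)^θ R^{3θ}` and the exponent algebra
      have hvol : (volume : Measure (EuclideanSpace ℝ (Fin 3))).real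
          (closedBall (0 : EuclideanSpace ℝ (Fin 3)) (2 * R n)) = 8 * V₁ * (R n) ^ 3 := by
        rw [Measure.addHaar_real_closedBall' volume 0 (by positivity), finrank_euclideanSpace_fin, hV₁]
        ring
      rw [hvol, show 8 * V₁ * (R n) ^ 3 = (8 * V₁) * (R n) ^ 3 by ring,
        Real.mul_rpow (by positivity) (by positivity), ← Real.rpow_natCast (R n) 3,
        ← Real.rpow_mul hR0.le]
      have e1 : (Real.pi * R n ^ 2)⁻¹ = Real.pi⁻¹ * (R n) ^ (-(2 : ℝ)) := by
        rw [mul_inv, Real.rpow_neg hR0.le]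
        norm_cast
      have e2 : C₁ / R n = C₁ * (R n) ^ (-(1 : ℝ)) := by
        rw [Real.rpow_neg hR0.le, Real.rpow_one, div_eq_mul_inv]
      rw [e1, e2, hK]
      have e3 : (R n) ^ (-(2 : ℝ)) * (R n) ^ (-(1 : ℝ)) * (R n) ^ ((3 : ℕ) * θ) =
          (R n) ^ (-(3 / p.toReal)) := by
        rw [← Real.rpow_add hR0, ← Real.rpow_add hR0]
        congr 1
        rw [hθ]; push_cast; ring
      rw [← e3]
      ring
    have hlim : Tendsto (fun n => K * (R n) ^ (-(3 / p.toReal))) atTop (𝓝 0) := by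
      have h1 : Tendsto (fun n => (R n) ^ (-(3 / p.toReal))) atTop (𝓝 0) :=
        (tendsto_rpow_neg_atTop (by positivity)).comp hR
      simpa using h1.const_mul K
    exact squeeze_zero_norm' hev hlim
  -- assemble the gradient from its coordinates
  have hrepr : ∀ n, gradient (divPotential fun y => cutoff (R n) y • a y) x =
      ∑ i, fderiv ℝ (divPotential fun y => cutoff (R n) y • a y) x (b i) • b i := by
    intro n
    conv_lhs => rw [← b.sum_repr' (gradient (divPotential fun y => cutoff (R n) y • a y) x)]
    refine Finset.sum_congr rfl fun i _ => ?_
    rw [inner_gradient_eq_fderiv_apply]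
  simp_rw [hrepr]
  have h := tendsto_finsetSum (Finset.univ) fun i (_ : i ∈ Finset.univ) =>
    (hdir (b i)).smul_const (b i)
  simpa using h

/-- **Smallness of the gradient part of the Calderón splitting** (Calderón 1990, §1; Albritton 2018,
(4.31)): for `1 < p < ∞` there is `C = C(p)` such that for every smooth divergence-free
`a ∈ L^p(ℝ³; ℝ³)` and every radius `ρ > 0`,
`‖∇π[χ_ρ a]‖_{L^p} ≤ C ‖(1 − χ_ρ) a‖_{L^p}`. Proof: for `R ≥ 2ρ`, `χ_ρ a + (1 − χ_ρ)χ_R a = χ_R a`,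
so `∇π[χ_ρ a] = ∇π[χ_R a] − ∇π[(1 − χ_ρ)χ_R a]`; the last term is bounded in `L^p` by
`C ‖(1 − χ_ρ)a‖_p` uniformly in `R` (`exists_eLpNorm_gradient_divPotential_le`), the first tends to
`0` pointwise as `R → ∞` (`tendsto_gradient_divPotential_cutoff_smul`); Fatou. [cite: Calderon1990, §1] -/
theorem exists_eLpNorm_gradient_divPotential_cutoff_le {p : ℝ≥0∞} (hp : 1 < p) (hp' : p < ⊤) :
    ∃ C : ℝ≥0, ∀ a : (EuclideanSpace ℝ (Fin 3)) → (EuclideanSpace ℝ (Fin 3)), ContDiff ℝ ∞ a →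
      MemLp a p volume → VectorCalculus.IsDivFree a → ∀ ρ : ℝ, 0 < ρ →
      eLpNorm (fun x => gradient (divPotential fun y => cutoff ρ y • a y) x) p volume ≤
        C * eLpNorm (fun y => (1 - cutoff ρ y) • a y) p volume := by
  obtain ⟨C, hC⟩ := exists_eLpNorm_gradient_divPotential_le hp hp'
  refine ⟨C, fun a ha haLp hdiv ρ hρ => ?_⟩
  -- the radii `R n = 2ρ + n + 1 → ∞` and the three fields
  set R : ℕ → ℝ := fun n => 2 * ρ + n + 1 with hRdef
  have hRpos : ∀ n, 0 < R n := fun n => by simp only [hRdef]; positivity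
  have hR2ρ : ∀ n, 2 * ρ ≤ R n := fun n => by simp only [hRdef]; linarith [(n.cast_nonneg : (0:ℝ) ≤ n)]
  have hRlim : Tendsto R atTop atTop := by
    refine tendsto_atTop_add_const_right _ 1 (tendsto_atTop_add_const_left _ (2 * ρ) ?_)
    exact tendsto_natCast_atTop_atTop
  set c : (EuclideanSpace ℝ (Fin 3)) → (EuclideanSpace ℝ (Fin 3)) := fun y => cutoff ρ y • a y with hc
  set h : ℕ → (EuclideanSpace ℝ (Fin 3)) → (EuclideanSpace ℝ (Fin 3)) := fun n y =>
    ((1 - cutoff ρ y) * cutoff (R n) y) • a y with hh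
  set A : ℕ → (EuclideanSpace ℝ (Fin 3)) → (EuclideanSpace ℝ (Fin 3)) := fun n y =>
    cutoff (R n) y • a y with hA
  have hcs : ContDiff ℝ ∞ c := contDiff_cutoff_smul ha ρ
  have hcc : HasCompactSupport c := hasCompactSupport_cutoff_smul a hρ
  have hhs : ∀ n, ContDiff ℝ ∞ (h n) := fun n =>
    ((contDiff_const.sub (contDiff_cutoff (E := EuclideanSpace ℝ (Fin 3)) ρ)).mul
      (contDiff_cutoff (E := EuclideanSpace ℝ (Fin 3)) (R n))).smul ha
  have hhc : ∀ n, HasCompactSupport (h n) := fun n => by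
    have h1 : HasCompactSupport fun y => (1 - cutoff ρ y) * cutoff (R n) y :=
      (hasCompactSupport_cutoff (E := EuclideanSpace ℝ (Fin 3)) (hRpos n)).mul_left
    exact h1.smul_right
  -- `c + h n = A n`
  have hsum : ∀ n, (fun y => c y + h n y) = A n := by
    intro n
    funext y
    simp only [hc, hh, hA, ← add_smul]
    congr 1
    by_cases hy : ‖y‖ ≤ R n
    · rw [cutoff_eq_one (hRpos n) hy]; ring
    · rw [not_le] at hy
      rw [cutoff_eq_zero hρ ((hR2ρ n).trans hy.le)]; ring
  have hident : ∀ n x, gradient (divPotential c) x =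
      gradient (divPotential (A n)) x - gradient (divPotential (h n)) x := by
    intro n x
    have e : divPotential (A n) = fun x => divPotential c x + divPotential (h n) x := by
      rw [← hsum n]; exact divPotential_add hcs hcc (hhs n) (hhc n)
    have hd1 : DifferentiableAt ℝ (divPotential c) x :=
      ((contDiff_divPotential hcs hcc).differentiable (by simp)) x
    have hd2 : DifferentiableAt ℝ (divPotential (h n)) x :=
      ((contDiff_divPotential (hhs n) (hhc n)).differentiable (by simp)) x
    rw [e, gradient_add_apply' hd1 hd2]
    abel
  -- the `L^p` bounds of `∇π[h n]`
  have hhle : ∀ n, eLpNorm (h n) p volume ≤ eLpNorm (fun y => (1 - cutoff ρ y) • a y) p volume := by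
    intro n
    refine eLpNorm_mono fun y => ?_
    simp only [hh, norm_smul, Real.norm_eq_abs, abs_mul]
    have h1 : |cutoff (R n) y| ≤ 1 := abs_cutoff_le_one _ _
    calc |1 - cutoff ρ y| * |cutoff (R n) y| * ‖a y‖ ≤ |1 - cutoff ρ y| * 1 * ‖a y‖ := by
          gcongr
      _ = |1 - cutoff ρ y| * ‖a y‖ := by ring
  have hgb : ∀ n, eLpNorm (fun x => gradient (divPotential (h n)) x) p volume ≤
      C * eLpNorm (fun y => (1 - cutoff ρ y) • a y) p volume := fun n =>
    (hC (h n) (hhs n) (hhc n)).2.trans (mul_le_mul_right (hhle n) _)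
  -- Fatou for `g n = ∇π[c] − ∇π[A n] = −∇π[h n] → ∇π[c]`
  set g : ℕ → (EuclideanSpace ℝ (Fin 3)) → (EuclideanSpace ℝ (Fin 3)) := fun n x =>
    gradient (divPotential c) x - gradient (divPotential (A n)) x with hg
  have hgeq : ∀ n, g n = fun x => -gradient (divPotential (h n)) x := by
    intro n; funext x; simp only [hg, hident n x]; abel
  have hgm : ∀ n, AEStronglyMeasurable (g n) volume := fun n => by
    rw [hgeq n]
    exact (contDiff_gradient_of_contDiff_top (contDiff_divPotential (hhs n) (hhc n))).continuous.neg.aestronglyMeasurable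
  have hgb' : ∀ n, eLpNorm (g n) p volume ≤ C * eLpNorm (fun y => (1 - cutoff ρ y) • a y) p volume := by
    intro n
    have e : (fun x => -gradient (divPotential (h n)) x) =
        -(fun x => gradient (divPotential (h n)) x) := rfl
    rw [hgeq n, e, eLpNorm_neg]
    exact hgb n
  have hglim : ∀ x, Tendsto (fun n => g n x) atTop (𝓝 (gradient (divPotential c) x)) := by
    intro x
    have h0 := tendsto_gradient_divPotential_cutoff_smul ha hp.le hp'.ne haLp hdiv hRlim x
    have := (tendsto_const_nhds (x := gradient (divPotential c) x)).sub h0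
    simpa [hg] using this
  calc eLpNorm (fun x => gradient (divPotential c) x) p volume
      ≤ atTop.liminf fun n => eLpNorm (g n) p volume :=
        Lp.eLpNorm_lim_le_liminf_eLpNorm hgm _ (Eventually.of_forall hglim)
    _ ≤ C * eLpNorm (fun y => (1 - cutoff ρ y) • a y) p volume :=
        liminf_le_of_frequently_le' (Frequently.of_forall hgb')

end Smallness


/-! ### §4 The splitting -/

section Splitting

variable {a : (EuclideanSpace ℝ (Fin 3)) → (EuclideanSpace ℝ (Fin 3))}

/-- **The `L^p` tail of the cut-off vanishes**: `‖(1 − χ_{n+1}) a‖_{L^p} → 0` for `a ∈ L^p`,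
`1 ≤ p < ∞` (dominated convergence: `1 − χ_{n+1}(y) = 0` as soon as `n + 1 ≥ ‖y‖`). [folklore] -/
theorem tendsto_eLpNorm_one_sub_cutoff_smul (ha : Continuous a) {p : ℝ≥0∞} (hp1 : 1 ≤ p)
    (hp : p ≠ ⊤) (haLp : MemLp a p volume) :
    Tendsto (fun n : ℕ => eLpNorm (fun y => (1 - cutoff ((n : ℝ) + 1) y) • a y) p volume)
      atTop (𝓝 0) := by
  have hp0 : p ≠ 0 := (zero_lt_one.trans_le hp1).ne'
  have hppos : 0 < p.toReal := ENNReal.toReal_pos hp0 hp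
  -- the `p`-th powers tend to zero by dominated convergence
  set I : ℕ → ℝ≥0∞ := fun n => ∫⁻ y, ‖(1 - cutoff ((n : ℝ) + 1) y) • a y‖ₑ ^ p.toReal with hI
  have hmeas : ∀ n : ℕ, Measurable fun y => ‖(1 - cutoff ((n : ℝ) + 1) y) • a y‖ₑ ^ p.toReal :=
    fun n => ((continuous_const.sub (continuous_cutoff ((n : ℝ) + 1))).smul ha).measurable.enorm.pow_const _
  have hbound : ∀ n : ℕ, ∀ᵐ y ∂(volume : Measure (EuclideanSpace ℝ (Fin 3))),
      ‖(1 - cutoff ((n : ℝ) + 1) y) • a y‖ₑ ^ p.toReal ≤ ‖a y‖ₑ ^ p.toReal := by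
    intro n
    refine Eventually.of_forall fun y => ENNReal.rpow_le_rpow ?_ hppos.le
    rw [enorm_smul]
    calc ‖1 - cutoff ((n : ℝ) + 1) y‖ₑ * ‖a y‖ₑ ≤ 1 * ‖a y‖ₑ := by
          refine mul_le_mul_left ?_ _
          rw [← ofReal_norm, Real.norm_eq_abs, ← ENNReal.ofReal_one]
          refine ENNReal.ofReal_le_ofReal (abs_le.2 ⟨?_, ?_⟩)
          · linarith [cutoff_le_one ((n : ℝ) + 1) y]
          · linarith [cutoff_nonneg ((n : ℝ) + 1) y]
      _ = ‖a y‖ₑ ^ (1 : ℝ) := by rw [one_mul, ENNReal.rpow_one]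
      _ = ‖a y‖ₑ := ENNReal.rpow_one _
  have hfin : ∫⁻ y, ‖a y‖ₑ ^ p.toReal ≠ ⊤ :=
    (lintegral_rpow_enorm_lt_top_of_eLpNorm_lt_top hp0 hp haLp.eLpNorm_lt_top).ne
  have hlim : ∀ᵐ y ∂(volume : Measure (EuclideanSpace ℝ (Fin 3))),
      Tendsto (fun n : ℕ => ‖(1 - cutoff ((n : ℝ) + 1) y) • a y‖ₑ ^ p.toReal) atTop (𝓝 0) := by
    refine Eventually.of_forall fun y => ?_
    have hev : ∀ᶠ n : ℕ in atTop, ‖(1 - cutoff ((n : ℝ) + 1) y) • a y‖ₑ ^ p.toReal = 0 := by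
      obtain ⟨N, hN⟩ := exists_nat_ge ‖y‖
      filter_upwards [eventually_ge_atTop N] with n hn
      have hn' : (N : ℝ) ≤ n := by exact_mod_cast hn
      rw [cutoff_eq_one (by positivity) (by linarith), sub_self, zero_smul, enorm_zero,
        ENNReal.zero_rpow_of_pos hppos]
    exact tendsto_const_nhds.congr' (hev.mono fun n hn => hn.symm)
  have hI0 : Tendsto I atTop (𝓝 0) := by
    have h := tendsto_lintegral_of_dominated_convergence (fun y => ‖a y‖ₑ ^ p.toReal) hmeas hbound
      hfin hlim
    simpa [hI] using h
  -- hence the norms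
  have heq : ∀ n : ℕ, eLpNorm (fun y => (1 - cutoff ((n : ℝ) + 1) y) • a y) p volume =
      (I n) ^ (1 / p.toReal) := fun n => eLpNorm_eq_lintegral_rpow_enorm_toReal hp0 hp
  simp_rw [heq]
  have hc : Tendsto (fun x : ℝ≥0∞ => x ^ (1 / p.toReal)) (𝓝 0) (𝓝 ((0 : ℝ≥0∞) ^ (1 / p.toReal))) :=
    (ENNReal.continuous_rpow_const.tendsto 0)
  rw [ENNReal.zero_rpow_of_pos (by positivity)] at hc
  exact hc.comp hI0

/-- **`∇π[G]` is bounded** for a test field `G` (the gradient of the Newtonian potential of the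
test function `div G`, `norm_fderiv_integral_newtonKernel_mul_le`). [folklore] -/
theorem exists_norm_gradient_divPotential_le {G : (EuclideanSpace ℝ (Fin 3)) → (EuclideanSpace ℝ (Fin 3))}
    (hG : ContDiff ℝ ∞ G) (hGc : HasCompactSupport G) :
    ∃ K : ℝ, ∀ x, ‖gradient (divPotential G) x‖ ≤ K := by
  set σ := VectorCalculus.divergence G with hσ
  have hσs : ContDiff ℝ ∞ σ := contDiff_divergence_of_contDiff_top hG
  have hσc : HasCompactSupport σ := hasCompactSupport_divergence hGc
  have hσ1 : ContDiff ℝ 1 σ := hσs.of_le (by norm_cast)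
  obtain ⟨B₁, hB₁⟩ := (hσ1.continuous_fderiv one_ne_zero).bounded_above_of_compact_support
    (hσc.fderiv (𝕜 := ℝ))
  refine ⟨B₁ + (4 * Real.pi)⁻¹ * ∫ x, ‖fderiv ℝ σ x‖, fun x => ?_⟩
  have e : divPotential G = fun y => ∫ t, newtonKernel (y - t) * σ t := funext (divPotential_apply G)
  rw [norm_gradient_eq_norm_fderiv, e]
  exact norm_fderiv_integral_newtonKernel_mul_le hσs hσc hB₁ x

/-- **Calderón's splitting of a smooth divergence-free `L^p` field** (Albritton 2018, proof of
Prop. 4.5, (4.31): "Following Calderón, for all `δ > 0`, there exist divergence-free vector fields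
`U₀ ∈ L²(ℝ³) ∩ L^p(ℝ³)` and `V₀ ∈ L^p(ℝ³)` such that `u₀ = U₀ + V₀`, `‖V₀‖_{L^p(ℝ³)} < δ`";
C. P. Calderón 1990, §1). For `1 < p < ∞`, a smooth bounded divergence-free `a ∈ L^p(ℝ³; ℝ³)` and
`η > 0` there are smooth divergence-free fields `U₀`, `V₀` with `a = U₀ + V₀` pointwise,
`U₀ ∈ L² ∩ L^p ∩ L^∞` and `V₀ ∈ L^p ∩ L^∞` with `‖V₀‖_{L^p} ≤ η`. Construction:
`U₀ = P[χ_ρ a] = χ_ρ a − ∇π[χ_ρ a]` (`classicalLerayProj`, smooth and solenoidal, `∇π[χ_ρ a] ∈ L² ∩ L^p`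
by `exists_eLpNorm_gradient_divPotential_le`, bounded by `exists_norm_gradient_divPotential_le`),
`V₀ = a − U₀ = (1 − χ_ρ)a + ∇π[χ_ρ a]`, with `‖V₀‖_p ≤ (1 + C_p)‖(1 − χ_ρ)a‖_p ≤ η` for `ρ` large
(`exists_eLpNorm_gradient_divPotential_cutoff_le`, `tendsto_eLpNorm_one_sub_cutoff_smul`).
[cite: Albritton2018, Prop. 4.5 proof, (4.31)] -/
theorem exists_calderon_splitting {p : ℝ≥0∞} (hp : 1 < p) (hp' : p < ⊤)
    (ha : ContDiff ℝ ∞ a) (haLp : MemLp a p volume) (hdiv : VectorCalculus.IsDivFree a)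
    {M : ℝ} (hM : ∀ x, ‖a x‖ ≤ M) {η : ℝ} (hη : 0 < η) :
    ∃ U₀ V₀ : (EuclideanSpace ℝ (Fin 3)) → (EuclideanSpace ℝ (Fin 3)),
      (∀ x, a x = U₀ x + V₀ x) ∧
      ContDiff ℝ ∞ U₀ ∧ VectorCalculus.IsDivFree U₀ ∧ MemLp U₀ 2 volume ∧ MemLp U₀ p volume ∧
      (∃ K : ℝ, ∀ x, ‖U₀ x‖ ≤ K) ∧
      ContDiff ℝ ∞ V₀ ∧ VectorCalculus.IsDivFree V₀ ∧ MemLp V₀ p volume ∧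
      (∃ K : ℝ, ∀ x, ‖V₀ x‖ ≤ K) ∧ eLpNorm V₀ p volume ≤ ENNReal.ofReal η := by
  have hp1 : 1 ≤ p := hp.le
  have hpt : p ≠ ⊤ := hp'.ne
  obtain ⟨C, hC⟩ := exists_eLpNorm_gradient_divPotential_cutoff_le hp hp'
  obtain ⟨C₂, hC₂⟩ := exists_eLpNorm_gradient_divPotential_le (p := 2) (by norm_num) (by norm_num)
  obtain ⟨Cp, hCp⟩ := exists_eLpNorm_gradient_divPotential_le hp hp'
  -- the radius: `(1 + C) ‖(1 - χ_ρ)a‖_p ≤ η`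
  set δ : ℝ := η / (1 + (C : ℝ)) with hδ
  have hδpos : 0 < δ := by rw [hδ]; positivity
  obtain ⟨n, hn⟩ : ∃ n : ℕ, eLpNorm (fun y => (1 - cutoff ((n : ℝ) + 1) y) • a y) p volume ≤
      ENNReal.ofReal δ :=
    ((tendsto_eLpNorm_one_sub_cutoff_smul ha.continuous hp1 hpt haLp).eventually
      (Iic_mem_nhds (ENNReal.ofReal_pos.2 hδpos))).exists
  set ρ : ℝ := (n : ℝ) + 1 with hρ
  have hρpos : 0 < ρ := by rw [hρ]; positivity
  -- the cut-off field and the two pieces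
  set c : (EuclideanSpace ℝ (Fin 3)) → (EuclideanSpace ℝ (Fin 3)) := fun y => cutoff ρ y • a y with hc
  have hcs : ContDiff ℝ ∞ c := contDiff_cutoff_smul ha ρ
  have hcc : HasCompactSupport c := hasCompactSupport_cutoff_smul a hρpos
  set U₀ : (EuclideanSpace ℝ (Fin 3)) → (EuclideanSpace ℝ (Fin 3)) := classicalLerayProj c with hU₀
  set V₀ : (EuclideanSpace ℝ (Fin 3)) → (EuclideanSpace ℝ (Fin 3)) := fun x => a x - U₀ x with hV₀
  have hU₀eq : U₀ = fun ξ => c ξ - gradient (divPotential c) ξ := rfl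
  have hU₀s : ContDiff ℝ ∞ U₀ := contDiff_classicalLerayProj hcs hcc
  have hU₀div : VectorCalculus.IsDivFree U₀ := isDivFree_classicalLerayProj hcs hcc
  have hgradc : Continuous fun x => gradient (divPotential c) x :=
    (contDiff_gradient_of_contDiff_top (contDiff_divPotential hcs hcc)).continuous
  -- `V₀ = (1 - χ_ρ)a + ∇π[c]`
  have hV₀eq : V₀ = fun x => (1 - cutoff ρ x) • a x + gradient (divPotential c) x := by
    funext x
    simp only [hV₀, hU₀eq, hc, sub_smul, one_smul]
    abel
  -- bounds
  obtain ⟨K, hK⟩ := exists_norm_gradient_divPotential_le hcs hcc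
  have hcle : ∀ x, ‖c x‖ ≤ M := fun x => by
    simp only [hc, norm_smul, Real.norm_eq_abs]
    calc |cutoff ρ x| * ‖a x‖ ≤ 1 * ‖a x‖ :=
          mul_le_mul_of_nonneg_right (abs_cutoff_le_one ρ x) (norm_nonneg _)
      _ ≤ M := by rw [one_mul]; exact hM x
  have hone : ∀ x, ‖(1 - cutoff ρ x) • a x‖ ≤ ‖a x‖ := fun x => by
    rw [norm_smul, Real.norm_eq_abs]
    calc |1 - cutoff ρ x| * ‖a x‖ ≤ 1 * ‖a x‖ := by
          refine mul_le_mul_of_nonneg_right (abs_le.2 ⟨?_, ?_⟩) (norm_nonneg _)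
          · linarith [cutoff_le_one ρ x]
          · linarith [cutoff_nonneg ρ x]
      _ = ‖a x‖ := one_mul _
  have htail_meas : AEStronglyMeasurable (fun x => (1 - cutoff ρ x) • a x) volume :=
    ((continuous_const.sub (continuous_cutoff ρ)).smul ha.continuous).aestronglyMeasurable
  have htailLp : MemLp (fun x => (1 - cutoff ρ x) • a x) p volume :=
    haLp.of_le htail_meas (Eventually.of_forall hone)
  have hgradL2 : MemLp (fun x => gradient (divPotential c) x) 2 volume := (hC₂ c hcs hcc).1
  have hgradLp : MemLp (fun x => gradient (divPotential c) x) p volume := (hCp c hcs hcc).1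
  have hcL2 : MemLp c 2 volume := hcs.continuous.memLp_of_hasCompactSupport hcc
  have hcLp : MemLp c p volume := hcs.continuous.memLp_of_hasCompactSupport hcc
  refine ⟨U₀, V₀, fun x => ?_, hU₀s, hU₀div, ?_, ?_, ⟨M + K, fun x => ?_⟩, ha.sub hU₀s, fun x => ?_,
    ?_, ⟨M + K, fun x => ?_⟩, ?_⟩
  · simp only [hV₀]; abel
  · rw [hU₀eq]; exact hcL2.sub hgradL2
  · rw [hU₀eq]; exact hcLp.sub hgradLp
  · rw [hU₀eq]
    exact (norm_sub_le _ _).trans (add_le_add (hcle x) (hK x))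
  · show VectorCalculus.divergence (fun y => a y - U₀ y) x = 0
    rw [divergence_sub_apply ((ha.differentiable (by simp)) x) ((hU₀s.differentiable (by simp)) x),
      hdiv x, hU₀div x, sub_zero]
  · rw [hV₀eq]; exact htailLp.add hgradLp
  · rw [hV₀eq]
    calc ‖(1 - cutoff ρ x) • a x + gradient (divPotential c) x‖
        ≤ ‖(1 - cutoff ρ x) • a x‖ + ‖gradient (divPotential c) x‖ := norm_add_le _ _
      _ ≤ M + K := add_le_add ((hone x).trans (hM x)) (hK x)
  · rw [hV₀eq]
    have hgrad_le : eLpNorm (fun x => gradient (divPotential c) x) p volume ≤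
        C * eLpNorm (fun y => (1 - cutoff ρ y) • a y) p volume := hC a ha haLp hdiv ρ hρpos
    have hn' : eLpNorm (fun y => (1 - cutoff ρ y) • a y) p volume ≤ ENNReal.ofReal δ := hn
    calc eLpNorm (fun x => (1 - cutoff ρ x) • a x + gradient (divPotential c) x) p volume
        ≤ eLpNorm (fun x => (1 - cutoff ρ x) • a x) p volume +
            eLpNorm (fun x => gradient (divPotential c) x) p volume :=
          eLpNorm_add_le htail_meas hgradc.aestronglyMeasurable hp1
      _ ≤ eLpNorm (fun x => (1 - cutoff ρ x) • a x) p volume +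
            C * eLpNorm (fun y => (1 - cutoff ρ y) • a y) p volume := by gcongr
      _ = (1 + C) * eLpNorm (fun x => (1 - cutoff ρ x) • a x) p volume := by ring
      _ ≤ (1 + C) * ENNReal.ofReal δ := by gcongr
      _ = ENNReal.ofReal η := by
          have e : ((1 : ℝ≥0∞) + C) = ENNReal.ofReal (1 + (C : ℝ)) := by
            rw [ENNReal.ofReal_add zero_le_one C.coe_nonneg, ENNReal.ofReal_one, ENNReal.ofReal_coe_nnreal]
          rw [e, ← ENNReal.ofReal_mul (by positivity), hδ]
          congr 1
          field_simp

end Splitting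


/-! ### §5 Smallness of `V₀` in `L^∞` (fields vanishing at infinity) -/

section SupSmall

variable {a : (EuclideanSpace ℝ (Fin 3)) → (EuclideanSpace ℝ (Fin 3))}

/-- Tails of a finite integral vanish on far-away balls: if `∫ f < ∞` on `ℝ³` then
`∫_{B_r(x₀)} f → 0` as `|x₀| → ∞` (continuity from above of the finite measure `f dx` along the
complements of `B̄_n(0)`). [folklore] -/
theorem tendsto_setLIntegral_ball_cocompact' {f : (EuclideanSpace ℝ (Fin 3)) → ℝ≥0∞}
    (hf : ∫⁻ x, f x ≠ ⊤) (r : ℝ) :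
    Tendsto (fun x₀ : EuclideanSpace ℝ (Fin 3) => ∫⁻ x in ball x₀ r, f x)
      (cocompact (EuclideanSpace ℝ (Fin 3))) (𝓝 0) := by
  set ν : Measure (EuclideanSpace ℝ (Fin 3)) := volume.withDensity f with hν
  set s : ℕ → Set (EuclideanSpace ℝ (Fin 3)) := fun n => (closedBall (0 : EuclideanSpace ℝ (Fin 3)) n)ᶜ
    with hs
  have hsmeas : ∀ n, MeasurableSet (s n) := fun n => measurableSet_closedBall.compl
  have hνs : ∀ n, ν (s n) = ∫⁻ x in s n, f x := fun n => withDensity_apply f (hsmeas n)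
  have hanti : Antitone s := fun m n hmn =>
    compl_subset_compl.2 (closedBall_subset_closedBall (by exact_mod_cast hmn))
  have hinter : ⋂ n, s n = ∅ := by
    ext x
    simp only [hs, mem_iInter, mem_compl_iff, mem_closedBall, dist_zero_right, not_le,
      mem_empty_iff_false, iff_false, not_forall, not_lt]
    exact exists_nat_ge ‖x‖
  have hfin : ∃ n, ν (s n) ≠ ⊤ := by
    refine ⟨0, ne_top_of_le_ne_top hf ?_⟩
    rw [hνs]
    exact setLIntegral_le_lintegral _ _
  have hlim : Tendsto (fun n => ν (s n)) atTop (𝓝 0) := by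
    have h := tendsto_measure_iInter_atTop (μ := ν) (fun n => (hsmeas n).nullMeasurableSet) hanti hfin
    rwa [hinter, measure_empty] at h
  refine ENNReal.tendsto_nhds_zero.2 fun ε hε => ?_
  obtain ⟨N, hN⟩ : ∃ N : ℕ, ν (s N) ≤ ε := ((ENNReal.tendsto_nhds_zero.1 hlim) ε hε).exists
  have hfar : ∀ᶠ x₀ in cocompact (EuclideanSpace ℝ (Fin 3)), (N : ℝ) + r < ‖x₀‖ :=
    tendsto_norm_cocompact_atTop.eventually (eventually_gt_atTop _)
  filter_upwards [hfar] with x₀ hx₀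
  have hsub : ball x₀ r ⊆ s N := by
    intro y hy
    rw [mem_ball, dist_eq_norm] at hy
    simp only [hs, mem_compl_iff, mem_closedBall, dist_zero_right, not_le]
    have h1 : ‖x₀‖ - ‖y‖ ≤ ‖x₀ - y‖ := norm_sub_norm_le x₀ y
    rw [norm_sub_rev] at h1
    linarith
  calc ∫⁻ x in ball x₀ r, f x ≤ ∫⁻ x in s N, f x := lintegral_mono_set hsub
    _ = ν (s N) := (hνs N).symm
    _ ≤ ε := hN

/-- **A Lipschitz `L^p` field vanishes at infinity**: if `f ∈ L^p(ℝ³)`, `1 ≤ p < ∞`, and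
`‖f x − f y‖ ≤ L ‖x − y‖`, then for every `ε > 0` there is `R` with `‖f x‖ ≤ ε` for `‖x‖ ≥ R`
(a value `> ε` forces `‖f‖ ≥ ε/2` on a ball of fixed radius, whose `L^p` mass cannot sit
arbitrarily far out). [folklore] -/
theorem exists_forall_norm_le_of_memLp_of_lipschitz {F' : Type*} [NormedAddCommGroup F']
    {f : (EuclideanSpace ℝ (Fin 3)) → F'} {p : ℝ≥0∞} (hp1 : 1 ≤ p) (hp : p ≠ ⊤)
    (hf : MemLp f p volume) {L : ℝ} (hL0 : 0 ≤ L) (hL : ∀ x y, ‖f x - f y‖ ≤ L * ‖x - y‖)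
    {ε : ℝ} (hε : 0 < ε) :
    ∃ R : ℝ, ∀ x, R ≤ ‖x‖ → ‖f x‖ ≤ ε := by
  have hp0 : p ≠ 0 := (zero_lt_one.trans_le hp1).ne'
  have hppos : 0 < p.toReal := ENNReal.toReal_pos hp0 hp
  -- the radius `r` on which a large value persists, and the mass threshold `m`
  set r : ℝ := ε / (2 * (L + 1)) with hr
  have hrpos : 0 < r := by rw [hr]; positivity
  have hLr : L * r ≤ ε / 2 := by
    rw [hr]
    have h1 : L * (ε / (2 * (L + 1))) = (L / (L + 1)) * (ε / 2) := by field_simp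
    rw [h1]
    have h2 : L / (L + 1) ≤ 1 := (div_le_one (by linarith)).2 (by linarith)
    nlinarith
  set m : ℝ≥0∞ := ENNReal.ofReal (ε / 2) ^ p.toReal *
    (ENNReal.ofReal (r ^ Module.finrank ℝ (EuclideanSpace ℝ (Fin 3))) *
      volume (ball (0 : EuclideanSpace ℝ (Fin 3)) 1)) with hm
  have hmpos : 0 < m := by
    refine ENNReal.mul_pos (ENNReal.rpow_pos (ENNReal.ofReal_pos.2 (by positivity))
      ENNReal.ofReal_ne_top).ne' (ENNReal.mul_pos (ENNReal.ofReal_pos.2 (by positivity)).ne'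
      (measure_ball_pos volume 0 one_pos).ne').ne'
  -- tails of `∫ ‖f‖^p` over balls of radius `r`
  have hfin : ∫⁻ x, ‖f x‖ₑ ^ p.toReal ≠ ⊤ :=
    (lintegral_rpow_enorm_lt_top_of_eLpNorm_lt_top hp0 hp hf.eLpNorm_lt_top).ne
  have hev := (tendsto_setLIntegral_ball_cocompact' hfin r).eventually (Iio_mem_nhds hmpos)
  obtain ⟨K, hK, hKP⟩ := (hasBasis_cocompact.eventually_iff).1 hev
  obtain ⟨R, hR⟩ := hK.isBounded.subset_closedBall 0
  refine ⟨R + 1, fun x hx => ?_⟩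
  have hxK : x ∈ Kᶜ := fun hxK => by
    have := mem_closedBall_zero_iff.1 (hR hxK)
    linarith
  have hsmall : ∫⁻ y in ball x r, ‖f y‖ₑ ^ p.toReal < m := hKP hxK
  -- if `‖f x‖ > ε`, the ball `B(x, r)` carries mass `≥ m`
  by_contra hcon
  rw [not_le] at hcon
  have hlow : ∀ y ∈ ball x r, ENNReal.ofReal (ε / 2) ≤ ‖f y‖ₑ := by
    intro y hy
    rw [mem_ball, dist_eq_norm] at hy
    have h1 : ‖f x‖ - ‖f y‖ ≤ L * ‖x - y‖ := by
      have := hL x y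
      linarith [norm_sub_norm_le (f x) (f y)]
    have h2 : L * ‖x - y‖ ≤ L * r := by
      rw [norm_sub_rev] at hy
      exact mul_le_mul_of_nonneg_left hy.le hL0
    have h3 : ε / 2 ≤ ‖f y‖ := by linarith
    rw [← ofReal_norm]
    exact ENNReal.ofReal_le_ofReal h3
  have hmass : m ≤ ∫⁻ y in ball x r, ‖f y‖ₑ ^ p.toReal := by
    calc m = ENNReal.ofReal (ε / 2) ^ p.toReal * volume (ball x r) := by
          rw [hm, Measure.addHaar_ball volume x hrpos.le]
      _ = ∫⁻ _ in ball x r, ENNReal.ofReal (ε / 2) ^ p.toReal := by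
          rw [setLIntegral_const]
      _ ≤ ∫⁻ y in ball x r, ‖f y‖ₑ ^ p.toReal := by
          refine setLIntegral_mono' measurableSet_ball fun y hy => ?_
          exact ENNReal.rpow_le_rpow (hlow y hy) hppos.le
  exact absurd (hmass.trans_lt hsmall) (lt_irrefl _)

/-- **`∇π[G]` in `L^∞` for a source in a ball**: if `G ∈ C_c^∞(ℝ³; ℝ³)` is supported in
`B̄(0, R')`, `R' > 0`, and `|div G| ≤ D`, then `|∂ᵥπ[G](x)| ≤ ‖v‖ D (1 + (4π)⁻¹|B₁|) R'` at every
`x` (kernel-gradient representation `∂ᵥπ[G](x) = ∫ ∂ᵥΓ(x − t) div G(t) dt`,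
`integral_newtonKernel_smul_fderiv_eq`; `‖DΓ(z)‖ ≤ (4π|z|²)⁻¹`, integrated over `|x − t| < R'`
and bounded by `(4πR'²)⁻¹` on the rest of the support). [folklore] -/
theorem abs_fderiv_divPotential_le_of_support {G : (EuclideanSpace ℝ (Fin 3)) → (EuclideanSpace ℝ (Fin 3))}
    (hG : ContDiff ℝ ∞ G) (hGc : HasCompactSupport G) {R' : ℝ} (hR' : 0 < R')
    (hsupp : tsupport G ⊆ closedBall (0 : EuclideanSpace ℝ (Fin 3)) R') {D : ℝ}
    (hD : ∀ t, |VectorCalculus.divergence G t| ≤ D) (x v : EuclideanSpace ℝ (Fin 3)) :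
    |fderiv ℝ (divPotential G) x v| ≤
      ‖v‖ * D * ((1 + (4 * Real.pi)⁻¹ * (volume : Measure (EuclideanSpace ℝ (Fin 3))).real
        (closedBall (0 : EuclideanSpace ℝ (Fin 3)) 1)) * R') := by
  have hD0 : 0 ≤ D := (abs_nonneg _).trans (hD 0)
  set σ : (EuclideanSpace ℝ (Fin 3)) → ℝ := VectorCalculus.divergence G with hσ
  have hσs : ContDiff ℝ ∞ σ := contDiff_divergence_of_contDiff_top hG
  have hσc : HasCompactSupport σ := hasCompactSupport_divergence hGc
  have hσ1 : ContDiff ℝ 1 σ := hσs.of_le (by norm_cast)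
  have hσ0 : ∀ t, R' < ‖t‖ → σ t = 0 := fun t ht =>
    divergence_eq_zero_of_notMem_tsupport fun h => by
      have := mem_closedBall_zero_iff.1 (hsupp h); linarith
  -- kernel-gradient representation
  have hrep : fderiv ℝ (divPotential G) x v = ∫ t, fderiv ℝ newtonKernel (x - t) v * σ t := by
    rw [divPotential, fderiv_convolution_newtonKernel_apply hσ1 hσc x v, convolution_newtonKernel_apply']
    have h := integral_newtonKernel_smul_fderiv_eq (F := ℝ) hσ1 hσc x v
    simp only [smul_eq_mul] at h
    exact h
  -- the majorant
  set V₁ := (volume : Measure (EuclideanSpace ℝ (Fin 3))).real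
    (closedBall (0 : (EuclideanSpace ℝ (Fin 3))) 1) with hV₁
  have hV₁0 : 0 ≤ V₁ := measureReal_nonneg
  set maj : (EuclideanSpace ℝ (Fin 3)) → ℝ := fun t =>
    ‖v‖ * D * ((4 * Real.pi)⁻¹ * nearProfile₂ R' ‖x - t‖ +
      (4 * Real.pi * R' ^ 2)⁻¹ * (closedBall (0 : EuclideanSpace ℝ (Fin 3)) R').indicator (fun _ => (1 : ℝ)) t)
    with hmaj
  have hind_int : Integrable ((closedBall (0 : EuclideanSpace ℝ (Fin 3)) R').indicator fun _ => (1 : ℝ))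
      volume :=
    (integrable_indicator_iff measurableSet_closedBall).2 (integrableOn_const (hs := measure_closedBall_lt_top.ne))
  have hmaj_int : Integrable maj volume := by
    refine (((integrable_nearProfile₂_norm hR').comp_sub_left x).const_mul _ |>.add
      (hind_int.const_mul _)).const_mul _
  have hle : ∀ t, ‖fderiv ℝ newtonKernel (x - t) v * σ t‖ ≤ maj t := by
    intro t
    by_cases ht : R' < ‖t‖
    · rw [hσ0 t ht, mul_zero, norm_zero]
      simp only [hmaj]
      refine mul_nonneg (mul_nonneg (norm_nonneg _) hD0) (add_nonneg ?_ ?_)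
      · exact mul_nonneg (by positivity) (nearProfile₂_nonneg _ _)
      · exact mul_nonneg (by positivity) (indicator_nonneg (fun _ _ => zero_le_one) _)
    · rw [not_lt] at ht
      have hmem : t ∈ closedBall (0 : EuclideanSpace ℝ (Fin 3)) R' := mem_closedBall_zero_iff.2 ht
      rw [norm_mul, Real.norm_eq_abs]
      have hk : ‖fderiv ℝ newtonKernel (x - t) v‖ ≤ (4 * Real.pi * ‖x - t‖ ^ 2)⁻¹ * ‖v‖ :=
        (ContinuousLinearMap.le_opNorm _ _).trans
          (mul_le_mul_of_nonneg_right (norm_fderiv_newtonKernel_le _) (norm_nonneg _))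
      have hker : (4 * Real.pi * ‖x - t‖ ^ 2)⁻¹ ≤ (4 * Real.pi)⁻¹ * nearProfile₂ R' ‖x - t‖ +
          (4 * Real.pi * R' ^ 2)⁻¹ * (closedBall (0 : EuclideanSpace ℝ (Fin 3)) R').indicator
            (fun _ => (1 : ℝ)) t := by
        rw [indicator_of_mem hmem, mul_one]
        by_cases hxt : ‖x - t‖ < R'
        · have e : nearProfile₂ R' ‖x - t‖ = (‖x - t‖ ^ 2)⁻¹ := if_pos hxt
          rw [e, mul_inv]
          linarith [show (0:ℝ) ≤ (4 * Real.pi * R' ^ 2)⁻¹ by positivity]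
        · rw [not_lt] at hxt
          have e : nearProfile₂ R' ‖x - t‖ = 0 := if_neg (not_lt.2 hxt)
          rw [e, mul_zero, zero_add]
          refine inv_anti₀ (by positivity) ?_
          have : R' ^ 2 ≤ ‖x - t‖ ^ 2 := pow_le_pow_left₀ hR'.le hxt 2
          nlinarith [Real.pi_pos]
      calc ‖fderiv ℝ newtonKernel (x - t) v‖ * |σ t|
          ≤ ((4 * Real.pi * ‖x - t‖ ^ 2)⁻¹ * ‖v‖) * D :=
            mul_le_mul hk (hD t) (abs_nonneg _) (by positivity)
        _ = ‖v‖ * D * (4 * Real.pi * ‖x - t‖ ^ 2)⁻¹ := by ring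
        _ ≤ maj t := by
            simp only [hmaj]
            exact mul_le_mul_of_nonneg_left hker (by positivity)
  have hint : ∫ t, maj t = ‖v‖ * D * ((4 * Real.pi)⁻¹ * (4 * Real.pi * R') +
      (4 * Real.pi * R' ^ 2)⁻¹ * (volume : Measure (EuclideanSpace ℝ (Fin 3))).real
        (closedBall (0 : EuclideanSpace ℝ (Fin 3)) R')) := by
    simp only [hmaj]
    rw [integral_const_mul, integral_add (((integrable_nearProfile₂_norm hR').comp_sub_left x).const_mul _)
      (hind_int.const_mul _), integral_const_mul, integral_const_mul,
      integral_indicator measurableSet_closedBall, setIntegral_const, smul_eq_mul, mul_one]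
    congr 2
    rw [integral_sub_left_eq_self (fun z : EuclideanSpace ℝ (Fin 3) => nearProfile₂ R' ‖z‖) volume x]
    rw [integral_nearProfile₂_norm_eq hR']
  rw [hrep, ← Real.norm_eq_abs]
  refine (norm_integral_le_of_norm_le hmaj_int (Eventually.of_forall hle)).trans ?_
  rw [hint, Measure.addHaar_real_closedBall' volume 0 hR'.le, finrank_euclideanSpace_fin, ← hV₁]
  have e : (4 * Real.pi)⁻¹ * (4 * Real.pi * R') + (4 * Real.pi * R' ^ 2)⁻¹ * (R' ^ 3 * V₁) =
      (1 + (4 * Real.pi)⁻¹ * V₁) * R' := by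
    field_simp
  rw [e]

/-- **The sup of `∇π[χ_ρ a]`**: for a smooth divergence-free `a` with `‖a(t)‖ ≤ S` for `‖t‖ ≥ ρ`,
`‖∇π[χ_ρ a](x)‖ ≤ 6 C₁ (1 + (4π)⁻¹|B₁|) S` at every `x`, `C₁` the gradient constant of the
cut-off (`|div(χ_ρ a)| ≤ (C₁/ρ) S`, supported in `B̄(0, 2ρ)`; `abs_fderiv_divPotential_le_of_support`
and `‖∇π‖ ≤ Σᵢ |∂ᵢπ|`). [folklore] -/
theorem norm_gradient_divPotential_cutoff_smul_le (ha : ContDiff ℝ ∞ a)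
    (hdiv : VectorCalculus.IsDivFree a) {C₁ : ℝ}
    (hC₁ : ∀ R : ℝ, 0 < R → ∀ x : EuclideanSpace ℝ (Fin 3), ‖fderiv ℝ (cutoff R) x‖ ≤ C₁ / R)
    {ρ S : ℝ} (hρ : 0 < ρ) (hS0 : 0 ≤ S) (hS : ∀ t, ρ ≤ ‖t‖ → ‖a t‖ ≤ S)
    (x : EuclideanSpace ℝ (Fin 3)) :
    ‖gradient (divPotential fun y => cutoff ρ y • a y) x‖ ≤
      6 * C₁ * (1 + (4 * Real.pi)⁻¹ * (volume : Measure (EuclideanSpace ℝ (Fin 3))).real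
        (closedBall (0 : EuclideanSpace ℝ (Fin 3)) 1)) * S := by
  set b := stdOrthonormalBasis ℝ (EuclideanSpace ℝ (Fin 3)) with hb
  set K₀ : ℝ := 1 + (4 * Real.pi)⁻¹ * (volume : Measure (EuclideanSpace ℝ (Fin 3))).real
    (closedBall (0 : EuclideanSpace ℝ (Fin 3)) 1) with hK₀
  have hK₀0 : 0 ≤ K₀ := by rw [hK₀]; positivity
  have hC₁0 : 0 ≤ C₁ := by
    have h := hC₁ 1 one_pos 0
    rw [div_one] at h
    exact (norm_nonneg _).trans h
  set G : (EuclideanSpace ℝ (Fin 3)) → (EuclideanSpace ℝ (Fin 3)) := fun y => cutoff ρ y • a y with hG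
  have hGs : ContDiff ℝ ∞ G := contDiff_cutoff_smul ha ρ
  have hGc : HasCompactSupport G := hasCompactSupport_cutoff_smul a hρ
  have hsupp : tsupport G ⊆ closedBall (0 : EuclideanSpace ℝ (Fin 3)) (2 * ρ) := by
    refine closure_minimal (fun y hy => ?_) isClosed_closedBall
    rw [mem_closedBall_zero_iff]
    by_contra hcon
    rw [not_le] at hcon
    exact hy (by simp [hG, cutoff_eq_zero hρ hcon.le])
  -- `|div G| ≤ (C₁/ρ) S`
  have hD : ∀ t, |VectorCalculus.divergence G t| ≤ C₁ / ρ * S := by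
    intro t
    by_cases ht : ‖t‖ < ρ
    · rw [show VectorCalculus.divergence G t = 0 from
        divergence_cutoff_smul_eq_zero ha hdiv hρ (Or.inl ht), abs_zero]
      positivity
    · rw [not_lt] at ht
      exact (abs_divergence_cutoff_smul_le ha hdiv hC₁ hρ t).trans
        (mul_le_mul_of_nonneg_left (hS t ht) (by positivity))
  have hdir : ∀ i, |fderiv ℝ (divPotential G) x (b i)| ≤ 2 * C₁ * K₀ * S := fun i => by
    have h := abs_fderiv_divPotential_le_of_support hGs hGc (by positivity : (0:ℝ) < 2 * ρ) hsupp hD x (b i)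
    rw [b.orthonormal.1 i, one_mul] at h
    refine h.trans_eq ?_
    rw [hK₀]; field_simp
  calc ‖gradient (divPotential G) x‖ ≤ ∑ i, |⟪b i, gradient (divPotential G) x⟫| :=
        norm_le_sum_abs_inner' b _
    _ = ∑ i, |fderiv ℝ (divPotential G) x (b i)| := by simp_rw [inner_gradient_eq_fderiv_apply]
    _ ≤ ∑ _i : Fin (Module.finrank ℝ (EuclideanSpace ℝ (Fin 3))), 2 * C₁ * K₀ * S :=
        Finset.sum_le_sum fun i _ => hdir i
    _ = 6 * C₁ * K₀ * S := by
        rw [Finset.sum_const, Finset.card_univ, Fintype.card_fin, finrank_euclideanSpace_fin]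
        simp only [nsmul_eq_mul]
        push_cast
        ring

/-- **Calderón's splitting with a small bounded part** (the form used for Albritton's class, whose
slices are Lipschitz): for `1 < p < ∞`, a smooth divergence-free `a ∈ L^p(ℝ³; ℝ³)` with
`‖a‖ ≤ M` and `‖Da‖ ≤ L`, and `η > 0`, there are smooth divergence-free `U₀`, `V₀` with
`a = U₀ + V₀`, `U₀ ∈ L² ∩ L^p ∩ L^∞`, and `V₀ ∈ L^p ∩ L^∞` small in BOTH norms:
`‖V₀‖_{L^p} ≤ η` and `‖V₀(x)‖ ≤ η` for all `x`. As in `exists_calderon_splitting`, with the radius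
`ρ` also beyond the range where `|a| ≤ η'` (`exists_forall_norm_le_of_memLp_of_lipschitz`), so that
`‖(1 − χ_ρ)a‖_∞ ≤ η'` and `‖∇π[χ_ρ a]‖_∞ ≤ 6C₁(1 + (4π)⁻¹|B₁|)η'`
(`norm_gradient_divPotential_cutoff_smul_le`). [cite: Albritton2018, Prop. 4.5 proof, (4.31)] -/
theorem exists_calderon_splitting_sup {p : ℝ≥0∞} (hp : 1 < p) (hp' : p < ⊤)
    (ha : ContDiff ℝ ∞ a) (haLp : MemLp a p volume) (hdiv : VectorCalculus.IsDivFree a)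
    {M : ℝ} (hM : ∀ x, ‖a x‖ ≤ M) {L : ℝ} (hL : ∀ x, ‖fderiv ℝ a x‖ ≤ L) {η : ℝ} (hη : 0 < η) :
    ∃ U₀ V₀ : (EuclideanSpace ℝ (Fin 3)) → (EuclideanSpace ℝ (Fin 3)),
      (∀ x, a x = U₀ x + V₀ x) ∧
      ContDiff ℝ ∞ U₀ ∧ VectorCalculus.IsDivFree U₀ ∧ MemLp U₀ 2 volume ∧ MemLp U₀ p volume ∧
      (∃ K : ℝ, ∀ x, ‖U₀ x‖ ≤ K) ∧
      ContDiff ℝ ∞ V₀ ∧ VectorCalculus.IsDivFree V₀ ∧ MemLp V₀ p volume ∧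
      (∀ x, ‖V₀ x‖ ≤ η) ∧ eLpNorm V₀ p volume ≤ ENNReal.ofReal η := by
  have hp1 : 1 ≤ p := hp.le
  have hpt : p ≠ ⊤ := hp'.ne
  have hL0 : 0 ≤ L := (norm_nonneg _).trans (hL 0)
  obtain ⟨C, hC⟩ := exists_eLpNorm_gradient_divPotential_cutoff_le hp hp'
  obtain ⟨C₂, hC₂⟩ := exists_eLpNorm_gradient_divPotential_le (p := 2) (by norm_num) (by norm_num)
  obtain ⟨Cp, hCp⟩ := exists_eLpNorm_gradient_divPotential_le hp hp'
  obtain ⟨C₁, hC₁0, hC₁⟩ := exists_norm_fderiv_cutoff_le (E := EuclideanSpace ℝ (Fin 3))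
  set K₀ : ℝ := 1 + (4 * Real.pi)⁻¹ * (volume : Measure (EuclideanSpace ℝ (Fin 3))).real
    (closedBall (0 : EuclideanSpace ℝ (Fin 3)) 1) with hK₀
  have hK₀0 : 0 ≤ K₀ := by rw [hK₀]; positivity
  -- the Lipschitz bound of `a`
  have hlip : ∀ x y, ‖a x - a y‖ ≤ L * ‖x - y‖ := fun x y => by
    have h := Convex.norm_image_sub_le_of_norm_fderiv_le (f := a) (s := univ)
      (fun z _ => (ha.differentiable (by simp)) z) (fun z _ => hL z) convex_univ (mem_univ y) (mem_univ x)
    simpa using h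
  -- the two smallness scales
  set δ : ℝ := η / (1 + (C : ℝ)) with hδ
  have hδpos : 0 < δ := by rw [hδ]; positivity
  set η' : ℝ := η / (1 + 6 * C₁ * K₀) with hη'
  have hη'pos : 0 < η' := by rw [hη']; positivity
  obtain ⟨N₁, hN₁⟩ : ∃ N₁ : ℕ, ∀ n ≥ N₁, eLpNorm (fun y => (1 - cutoff ((n : ℝ) + 1) y) • a y) p volume ≤
      ENNReal.ofReal δ :=
    eventually_atTop.1 ((tendsto_eLpNorm_one_sub_cutoff_smul ha.continuous hp1 hpt haLp).eventually
      (Iic_mem_nhds (ENNReal.ofReal_pos.2 hδpos)))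
  obtain ⟨R₂, hR₂⟩ := exists_forall_norm_le_of_memLp_of_lipschitz hp1 hpt haLp hL0 hlip hη'pos
  obtain ⟨N₂, hN₂⟩ := exists_nat_ge R₂
  set n : ℕ := max N₁ N₂ with hn
  set ρ : ℝ := (n : ℝ) + 1 with hρ
  have hρpos : 0 < ρ := by rw [hρ]; positivity
  have hρR₂ : R₂ ≤ ρ := by
    have : (N₂ : ℝ) ≤ n := by rw [hn]; exact_mod_cast le_max_right N₁ N₂
    rw [hρ]; linarith
  have hfar : ∀ t, ρ ≤ ‖t‖ → ‖a t‖ ≤ η' := fun t ht => hR₂ t (hρR₂.trans ht)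
  have hn₁ : eLpNorm (fun y => (1 - cutoff ρ y) • a y) p volume ≤ ENNReal.ofReal δ :=
    hN₁ n (le_max_left _ _)
  -- the cut-off field and the two pieces
  set c : (EuclideanSpace ℝ (Fin 3)) → (EuclideanSpace ℝ (Fin 3)) := fun y => cutoff ρ y • a y with hc
  have hcs : ContDiff ℝ ∞ c := contDiff_cutoff_smul ha ρ
  have hcc : HasCompactSupport c := hasCompactSupport_cutoff_smul a hρpos
  set U₀ : (EuclideanSpace ℝ (Fin 3)) → (EuclideanSpace ℝ (Fin 3)) := classicalLerayProj c with hU₀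
  set V₀ : (EuclideanSpace ℝ (Fin 3)) → (EuclideanSpace ℝ (Fin 3)) := fun x => a x - U₀ x with hV₀
  have hU₀eq : U₀ = fun ξ => c ξ - gradient (divPotential c) ξ := rfl
  have hU₀s : ContDiff ℝ ∞ U₀ := contDiff_classicalLerayProj hcs hcc
  have hU₀div : VectorCalculus.IsDivFree U₀ := isDivFree_classicalLerayProj hcs hcc
  have hgradc : Continuous fun x => gradient (divPotential c) x :=
    (contDiff_gradient_of_contDiff_top (contDiff_divPotential hcs hcc)).continuous
  have hV₀eq : V₀ = fun x => (1 - cutoff ρ x) • a x + gradient (divPotential c) x := by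
    funext x
    simp only [hV₀, hU₀eq, hc, sub_smul, one_smul]
    abel
  obtain ⟨K, hK⟩ := exists_norm_gradient_divPotential_le hcs hcc
  have hcle : ∀ x, ‖c x‖ ≤ M := fun x => by
    simp only [hc, norm_smul, Real.norm_eq_abs]
    calc |cutoff ρ x| * ‖a x‖ ≤ 1 * ‖a x‖ :=
          mul_le_mul_of_nonneg_right (abs_cutoff_le_one ρ x) (norm_nonneg _)
      _ ≤ M := by rw [one_mul]; exact hM x
  have hone : ∀ x, ‖(1 - cutoff ρ x) • a x‖ ≤ ‖a x‖ := fun x => by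
    rw [norm_smul, Real.norm_eq_abs]
    calc |1 - cutoff ρ x| * ‖a x‖ ≤ 1 * ‖a x‖ := by
          refine mul_le_mul_of_nonneg_right (abs_le.2 ⟨?_, ?_⟩) (norm_nonneg _)
          · linarith [cutoff_le_one ρ x]
          · linarith [cutoff_nonneg ρ x]
      _ = ‖a x‖ := one_mul _
  -- sup smallness of the tail: `(1 - χ_ρ)a` vanishes on `‖x‖ ≤ ρ` and is `≤ η'` beyond
  have hone' : ∀ x, ‖(1 - cutoff ρ x) • a x‖ ≤ η' := fun x => by
    by_cases hx : ‖x‖ ≤ ρ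
    · rw [cutoff_eq_one hρpos hx, sub_self, zero_smul, norm_zero]; exact hη'pos.le
    · exact (hone x).trans (hfar x (not_le.1 hx).le)
  have hgrad_sup : ∀ x, ‖gradient (divPotential c) x‖ ≤ 6 * C₁ * K₀ * η' := fun x =>
    norm_gradient_divPotential_cutoff_smul_le ha hdiv hC₁ hρpos hη'pos.le hfar x
  have htail_meas : AEStronglyMeasurable (fun x => (1 - cutoff ρ x) • a x) volume :=
    ((continuous_const.sub (continuous_cutoff ρ)).smul ha.continuous).aestronglyMeasurable
  have htailLp : MemLp (fun x => (1 - cutoff ρ x) • a x) p volume :=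
    haLp.of_le htail_meas (Eventually.of_forall hone)
  have hgradL2 : MemLp (fun x => gradient (divPotential c) x) 2 volume := (hC₂ c hcs hcc).1
  have hgradLp : MemLp (fun x => gradient (divPotential c) x) p volume := (hCp c hcs hcc).1
  have hcL2 : MemLp c 2 volume := hcs.continuous.memLp_of_hasCompactSupport hcc
  have hcLp : MemLp c p volume := hcs.continuous.memLp_of_hasCompactSupport hcc
  refine ⟨U₀, V₀, fun x => ?_, hU₀s, hU₀div, ?_, ?_, ⟨M + K, fun x => ?_⟩, ha.sub hU₀s, fun x => ?_,
    ?_, fun x => ?_, ?_⟩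
  · simp only [hV₀]; abel
  · rw [hU₀eq]; exact hcL2.sub hgradL2
  · rw [hU₀eq]; exact hcLp.sub hgradLp
  · rw [hU₀eq]
    exact (norm_sub_le _ _).trans (add_le_add (hcle x) (hK x))
  · show VectorCalculus.divergence (fun y => a y - U₀ y) x = 0
    rw [divergence_sub_apply ((ha.differentiable (by simp)) x) ((hU₀s.differentiable (by simp)) x),
      hdiv x, hU₀div x, sub_zero]
  · rw [hV₀eq]; exact htailLp.add hgradLp
  · rw [hV₀eq]
    calc ‖(1 - cutoff ρ x) • a x + gradient (divPotential c) x‖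
        ≤ ‖(1 - cutoff ρ x) • a x‖ + ‖gradient (divPotential c) x‖ := norm_add_le _ _
      _ ≤ η' + 6 * C₁ * K₀ * η' := add_le_add (hone' x) (hgrad_sup x)
      _ = (1 + 6 * C₁ * K₀) * η' := by ring
      _ = η := by rw [hη']; field_simp
  · rw [hV₀eq]
    have hgrad_le : eLpNorm (fun x => gradient (divPotential c) x) p volume ≤
        C * eLpNorm (fun y => (1 - cutoff ρ y) • a y) p volume := hC a ha haLp hdiv ρ hρpos
    calc eLpNorm (fun x => (1 - cutoff ρ x) • a x + gradient (divPotential c) x) p volume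
        ≤ eLpNorm (fun x => (1 - cutoff ρ x) • a x) p volume +
            eLpNorm (fun x => gradient (divPotential c) x) p volume :=
          eLpNorm_add_le htail_meas hgradc.aestronglyMeasurable hp1
      _ ≤ eLpNorm (fun x => (1 - cutoff ρ x) • a x) p volume +
            C * eLpNorm (fun y => (1 - cutoff ρ y) • a y) p volume := by gcongr
      _ = (1 + C) * eLpNorm (fun x => (1 - cutoff ρ x) • a x) p volume := by ring
      _ ≤ (1 + C) * ENNReal.ofReal δ := by gcongr
      _ = ENNReal.ofReal η := by
          have e : ((1 : ℝ≥0∞) + C) = ENNReal.ofReal (1 + (C : ℝ)) := by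
            rw [ENNReal.ofReal_add zero_le_one C.coe_nonneg, ENNReal.ofReal_one, ENNReal.ofReal_coe_nnreal]
          rw [e, ← ENNReal.ofReal_mul (by positivity), hδ]
          congr 1
          field_simp

end SupSmall

end CalderonSplittingLp

end Literature.Analysis.FluidPDE

end
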